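import Mathlib
import HarnessLib

/-!
# Twisted orbit sums and the index `P²` (Clark–Sharif 2010, §3.6, cocycle-level form)

Topic `NumberTheory/EllipticCurves`; theorems only (no definition, no named fact). Part of the
inline proof programme of the named fact
`Literature.NumberTheory.EllipticCurves.ClarkSharif2010_thm2` (`PeriodIndex`; Clark–Sharif,
*Period, index and potential Ш*, ANT 4 (2010), Theorem 2), whose remaining arithmetic core after
`PeriodIndexThm2Reduction` (`ClarkSharif2010_thm2_of_kummerClasses`) and
`PeriodIndexRationalDivisor` (`index_dvd_addOrderOf_sq`, `I ∣ P²`) is the **lower bound**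
`P² ∣ I(η_i - η_j)`: every finite extension `M/K` splitting `η = [ξ]` has `P² ∣ [M : K]`.

## The printed argument and its cocycle-level shadow

Clark–Sharif prove `I(C) = P²` in §3.6 through the period–index obstruction map: a rational
divisor of degree `PD` gives a Kummer lift `ν ∈ H¹(K, E[PD])` with `Δ_{PD}(ν) = 0`; `ν` differs
from `j(ξ)` by the Kummer class of a *global* point `x ∈ E(K)`; locally at the place `w = ṽ_m`
(split in `K_P = K(E[P*])`, good, `w ∤ P`) the Tate pairing `Li(η, x)_w` vanishes because `x`
is `P`-divisible in `E(K_w)` (condition (SC2′)), while `Δ_{PD}(jξ) = D Δ_P(ξ)` and `Δ_P(ξ)_w`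
has order `P` (Lemma 19, Theorem 10: the obstruction is the Hilbert symbol
`⟨a_m, b_m⟩_w` of a uniformiser against a unit of order `P`), whence `D = P`. None of the
theories involved (Brauer groups with local invariants, O'Neil's `Δ`, Lichtenbaum–Tate duality,
level-`P` Hilbert symbols) is available in Lean. This file proves the **same local comparison at
the level of cocycles and points**, where it becomes an elementary (if long) statement about a
group `G` (the decomposition group at `w`) acting on an abelian group `A` (`= E(K̄)`):

* A splitting field `M` of degree `d` gives a point `R` of the torsor fixed by `Γ_M` for the
  twisted action `σ ⋆ R = σ R + ξ(σ)`, hence a `⋆`-invariant multiset `D` (the trace of `R`) of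
  cardinality `d` whose sum `s` satisfies `d ξ = -∂ s`; so `s ∈ E(K)` and, by (SC2′), `s = P y`
  with `y` fixed by `G` (this global bookkeeping is NOT in this file).
* Locally `ξ|_G = χ₁ T₁ + χ₂ T₂` with `χ₁|_I` onto `ℤ/P` (Kummer character of the uniformiser
  `a_m`), `χ₂` unramified with `χ₂(F)` a unit (Lemma 18's choice of `θ_m`), and `E[P] ⊂ A^G`.
  **Main theorem** (`TwistedOrbit.sq_dvd_card_of_twistInvariant`): every finite `⋆`-invariant
  multiset `D ⊂ A` whose sum is `P ·`(a `G`-invariant element) has `P² ∣ card D`.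
* Per twisted orbit (`TwistedOrbit.orbit_formula`; point `R`, stabiliser `U`, `d_U = [G : U]`):
  `P ∣ d_U` and `F s̃ - s̃ ≡ -(d_U / P) χ₂(F) T₂ (mod ℤ T₁)` for every `P`-th root `s̃` of the
  orbit sum — the shadow of "`Δ_{PD}(jξ)_w = D Δ_P(ξ)_w` has order `P/D`" paired against the
  shadow "`F ỹ - ỹ = 0`" of `Li(η, x)_w = 0`. Summing over the orbits of `D` gives
  `P ∣ (card D / P) · χ₂(F)`, and `χ₂(F)` is a unit.
* The orbit formula: shift by a reference point `R₁ ∈ A^I` with `∂R₁ = -χ₂ T₂`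
  (`exists_shift_point`) to the torsor of `χ₁ T₁`; for `z` with stabiliser `H`, elements of
  `H ∩ I` fix `z` and lie in `ker χ₁` (`smul_eq_and_char_eq_zero_of_mem_inf`, from the
  unramifiedness hypothesis `hunr`: `P`-division points of `I`-invariants are `I`-invariant);
  a **nice point** `w ∈ A^I` with `∂w|_H = -χ₁ T₁|_H` exists (`exists_nicePoint`, from the
  supply `hnice` of solutions of `F^f w - w = a`, `a ∈ A[P]`, in `A^I` — in the application
  torsion points, replacing Lang's theorem over unramified extensions); with `u = z - w ∈ A^H`
  the orbit sum splits into the nice orbit sum of `w`, computed through the fibration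
  `G/H → G/HI` whose fibres are `I`-orbits, i.e. translations by the (equidistributed) values of
  `χ₁` (`exists_root_niceOrbitSum`; this also gives `P ∣ [HI : H]`), and the norm
  `∑ q.out • u`, whose `P`-th root `∑ q.out • ũ` is moved by `F` through the **transfer** of `F`
  evaluated on the homomorphism `κ(h) = h ũ - ũ` of `H`, which kills `H ∩ I` and an open normal
  subgroup; modulo those, `G` is cyclic generated by `F` (density hypothesis `hdens`), the
  transfer of `F` is `F^{[G:H]} ≡ h₀^{P N₀}`, and `P κ = 0` (`smul_normRoot_sub_self`).

All hypotheses are stated abstractly (a predicate `Op` on subgroups for "open": stable under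
`⊓`, containing stabilisers and `ker χᵢ`, cofinal among normal subgroups, of finite index, with
`G = ⋃ₙ Fⁿ · I · U` for `Op U`); their discharge for the decomposition group of a number field
at a good place (open subgroups of a profinite group; `exists_eq_frobenius_pow_mul_of_mem_decompositionSubgroup`
of `GaloisRepresentations/FrobeniusGeneration`; `WeierstrassCurve.smul_geomPoints_eq_of_mem_inertia`
of `GoodReductionUnramifiedProofs`; divisibility of `E(K̄)`; `E[2P] ⊂ E(K_P)` for even `P`;
surjectivity of `F^f - 1` on `E[p^∞]`) is the business of the sequel files.

## References

* P. L. Clark, S. Sharif, *Period, index and potential Ш*, Algebra & Number Theory 4 (2010)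
  151–174, §3.5 (Lemma 15, Prop. 16, Cor. 17, Lemmas 18–19) and §3.6 (`ClarkSharif2010`;
  arXiv:0811.3019 read in full: the statement proved here is the content of the first two
  paragraphs of §3.6, re-proved without the obstruction map).
* J.-P. Serre, *Galois Cohomology* (1997), I.§2.4 and I.§5 (corestriction/transfer, twisting)
  (`SerreGaloisCohomology1997`).
* J. H. Silverman, *The Arithmetic of Elliptic Curves*, 2nd ed. (2009), X.§2–3 (torsors and the
  twisted action) (`SilvermanAEC2009`).

## Design

`noncomputable section`, `open scoped Classical`; sums over coset spaces `G ⧸ H` use explicit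
`[Fintype (G ⧸ H)]` arguments (supplied by `Fintype.ofFinite` at the call sites); the twisted
action is written out (`σ • R + ξ σ`), stabilisers and kernels are passed with their membership
characterisations (`hU : ∀ g, g ∈ U ↔ …`), so that no definition is introduced. Grouping
namespace `TwistedOrbit`. Axioms: `propext`, `Classical.choice`, `Quot.sound`.
-/

noncomputable section

open scoped Classical Pointwise

namespace Literature.NumberTheory.EllipticCurves

namespace TwistedOrbit

variable {G : Type*} [Group G] {A : Type*} [AddCommGroup A] [DistribMulAction G A]

/-! ### Scalar bookkeeping for `P`-torsion elements -/

/-- Multiples of a `P`-torsion element only depend on the multiplier modulo `P`. [folklore] -/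
theorem nsmul_eq_mod_nsmul {P : ℕ} {T : A} (hT : P • T = 0) (n : ℕ) : n • T = (n % P) • T := by
  conv_lhs => rw [← Nat.mod_add_div n P]
  rw [add_nsmul, mul_nsmul, hT, nsmul_zero, add_zero]

/-- A multiple of a `P`-torsion element is `P`-torsion. [folklore] -/
theorem nsmul_nsmul_eq_zero {P : ℕ} {T : A} (hT : P • T = 0) (n : ℕ) : P • (n • T) = 0 := by
  rw [← mul_nsmul', mul_comm, mul_nsmul', hT, nsmul_zero]

/-- `(a + b).val • T = a.val • T + b.val • T` for `P • T = 0`. [folklore] -/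
theorem val_add_nsmul {P : ℕ} [NeZero P] {T : A} (hT : P • T = 0) (a b : ZMod P) :
    (a + b).val • T = a.val • T + b.val • T := by
  rw [ZMod.val_add, ← nsmul_eq_mod_nsmul hT, add_nsmul]

/-- `(n : ZMod P).val • T = n • T` for `P • T = 0`. [folklore] -/
theorem val_natCast_nsmul {P : ℕ} [NeZero P] {T : A} (hT : P • T = 0) (n : ℕ) :
    ((n : ZMod P).val) • T = n • T := by
  rw [ZMod.val_natCast, ← nsmul_eq_mod_nsmul hT]

/-- `(n • a).val • T = n • (a.val • T)` for `P • T = 0`. [folklore] -/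
theorem val_nsmul_nsmul {P : ℕ} [NeZero P] {T : A} (hT : P • T = 0) (n : ℕ) (a : ZMod P) :
    (n • a).val • T = n • (a.val • T) := by
  rw [nsmul_eq_mul, ZMod.val_mul, ← nsmul_eq_mod_nsmul hT, ZMod.val_natCast, mul_nsmul',
    ← nsmul_eq_mod_nsmul (nsmul_nsmul_eq_zero hT _)]

/-- `(-a).val • T = -(a.val • T)` for `P • T = 0`. [folklore] -/
theorem val_neg_nsmul {P : ℕ} [NeZero P] {T : A} (hT : P • T = 0) (a : ZMod P) :
    (-a).val • T = -(a.val • T) := by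
  have h := val_add_nsmul hT a (-a)
  rw [add_neg_cancel, ZMod.val_zero, zero_nsmul] at h
  exact (neg_eq_of_add_eq_zero_right h.symm).symm

/-- The value of a `ZMod P`-valued character at a power. [folklore] -/
theorem char_pow {P : ℕ} (χ : G → ZMod P) (hχ : ∀ σ τ, χ (σ * τ) = χ σ + χ τ) (g : G) (n : ℕ) :
    χ (g ^ n) = n • χ g := by
  have h1 : χ 1 = 0 := by simpa using hχ 1 1
  induction n with
  | zero => rw [pow_zero, zero_nsmul, h1]
  | succ k ih => rw [pow_succ, hχ, ih, succ_nsmul]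

/-- A `ZMod P`-valued character kills inverses up to sign. [folklore] -/
theorem char_inv {P : ℕ} (χ : G → ZMod P) (hχ : ∀ σ τ, χ (σ * τ) = χ σ + χ τ) (g : G) :
    χ g⁻¹ = -χ g := by
  have h1 : χ 1 = 0 := by simpa using hχ 1 1
  have h := hχ g⁻¹ g
  rw [inv_mul_cancel, h1] at h
  exact (neg_eq_of_add_eq_zero_left h.symm).symm

/-- A `ZMod P`-valued character is a class function. [folklore] -/
theorem char_conj {P : ℕ} (χ : G → ZMod P) (hχ : ∀ σ τ, χ (σ * τ) = χ σ + χ τ) (g x : G) :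
    χ (g * x * g⁻¹) = χ x := by
  rw [hχ, hχ, char_inv χ hχ]; abel

/-- The kernel of a `ZMod P`-valued character, as a subgroup (existence form: no definition is
introduced). [folklore] -/
theorem exists_charKer {P : ℕ} (χ : G → ZMod P) (hχ : ∀ σ τ, χ (σ * τ) = χ σ + χ τ) :
    ∃ K : Subgroup G, ∀ g, g ∈ K ↔ χ g = 0 := by
  have h1 : χ 1 = 0 := by simpa using hχ 1 1
  refine ⟨{ carrier := {g | χ g = 0}
            mul_mem' := fun {a b} ha hb ↦ by
              simp only [Set.mem_setOf_eq] at ha hb ⊢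
              rw [hχ, ha, hb, add_zero]
            one_mem' := h1
            inv_mem' := fun {a} ha ↦ by
              simp only [Set.mem_setOf_eq] at ha ⊢
              rw [char_inv χ hχ, ha, neg_zero] }, fun g ↦ Iff.rfl⟩

/-! ### Sums over coset spaces -/

omit [DistribMulAction G A] in
/-- Sums over `G ⧸ H` of a right-`H`-invariant function regroup along `G ⧸ L` for `H ≤ L`:
`∑_{G/H} f = ∑_{Q ∈ G/L} ∑_{r ∈ L/H} f(Q.out · r.out)`. [folklore] -/
theorem sum_quotient_eq_sum_sum {H L : Subgroup G} (hHL : H ≤ L) [Fintype (G ⧸ H)]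
    [Fintype (G ⧸ L)] [Fintype (L ⧸ H.subgroupOf L)] (f : G → A)
    (hf : ∀ g, ∀ h ∈ H, f (g * h) = f g) :
    ∑ q : G ⧸ H, f q.out = ∑ Q : G ⧸ L, ∑ r : L ⧸ H.subgroupOf L, f (Q.out * r.out) := by
  have hlift : ∀ g : G, f ((g : G ⧸ H).out) = f g := fun g ↦ by
    obtain ⟨h, hh⟩ := QuotientGroup.mk_out_eq_mul H g
    rw [hh, hf g h h.2]
  rw [← Fintype.sum_prod_type']
  rw [← (Subgroup.quotientEquivProdOfLE hHL).symm.sum_comp]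
  refine Fintype.sum_congr _ _ fun x ↦ ?_
  obtain ⟨Q, r⟩ := x
  simp only
  have hr : r = (r.out : L ⧸ H.subgroupOf L) := (Quotient.out_eq r).symm
  conv_lhs => rw [hr]
  rw [show ((Subgroup.quotientEquivProdOfLE hHL).symm (Q, (r.out : L ⧸ H.subgroupOf L))) =
      ((Q.out * (r.out : G) : G) : G ⧸ H) from rfl]
  exact hlift _

/-- The class of `F * q.out` in `G ⧸ H` is `F • q`, so `(F • q).out = F * q.out * h` for some
`h ∈ H` (the Schreier element). [folklore] -/
theorem exists_smul_out_eq (H : Subgroup G) (F : G) (q : G ⧸ H) :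
    ∃ h ∈ H, (F • q).out = F * q.out * h := by
  obtain ⟨h, hh⟩ := QuotientGroup.mk_out_eq_mul H (F * q.out)
  refine ⟨h, h.2, ?_⟩
  rw [← hh, ← MulAction.Quotient.coe_smul_out, smul_eq_mul]


/-! ### The twisted action `σ ⋆ R = σ • R + ξ σ` of a homomorphism `ξ` with invariant values -/

section Twist

variable (ξ : G → A) (hξm : ∀ σ τ, ξ (σ * τ) = ξ σ + ξ τ) (hξf : ∀ σ τ : G, σ • ξ τ = ξ τ)
include hξm

omit [DistribMulAction G A] in
/-- `ξ 1 = 0`. [folklore] -/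
theorem map_one_eq_zero : ξ 1 = 0 := by simpa using hξm 1 1

/-- `1 ⋆ R = R`. [folklore] -/
theorem twist_one (R : A) : (1 : G) • R + ξ 1 = R := by
  rw [one_smul, map_one_eq_zero ξ hξm, add_zero]

include hξf

/-- `(σ τ) ⋆ R = σ ⋆ (τ ⋆ R)`: the twisted action is an action (`ξ` is a homomorphism with
`G`-invariant values, i.e. a cocycle). Silverman, *AEC*, X.§2–3. [folklore] -/
theorem twist_mul (σ τ : G) (R : A) : (σ * τ) • R + ξ (σ * τ) = σ • (τ • R + ξ τ) + ξ σ := by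
  rw [mul_smul, smul_add, hξf, hξm]
  abel

/-- `σ⁻¹ ⋆ (σ ⋆ R) = R`. [folklore] -/
theorem twist_inv_twist (σ : G) (R : A) : σ⁻¹ • (σ • R + ξ σ) + ξ σ⁻¹ = R := by
  rw [← twist_mul ξ hξm hξf, inv_mul_cancel, twist_one ξ hξm]

/-- The twisted stabiliser `{σ | σ ⋆ R = R}` is a subgroup (existence form). [folklore] -/
theorem exists_twistStab (R : A) : ∃ U : Subgroup G, ∀ g, g ∈ U ↔ g • R + ξ g = R := by
  refine ⟨{ carrier := {g | g • R + ξ g = R}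
            mul_mem' := fun {g h} hg hh ↦ by
              simp only [Set.mem_setOf_eq] at hg hh ⊢
              rw [twist_mul ξ hξm hξf, hh, hg]
            one_mem' := twist_one ξ hξm R
            inv_mem' := fun {g} hg ↦ by
              simp only [Set.mem_setOf_eq] at hg ⊢
              conv_lhs => rw [← hg]
              exact twist_inv_twist ξ hξm hξf g R }, fun g ↦ Iff.rfl⟩

/-- `(g h) ⋆ R = g ⋆ R` for `h` in a subgroup fixing `R` under the twisted action. [folklore] -/
theorem twist_mul_of_mem {R : A} {H : Subgroup G} (hH : ∀ h ∈ H, h • R + ξ h = R) (g : G) {h : G}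
    (hh : h ∈ H) : (g * h) • R + ξ (g * h) = g • R + ξ g := by
  rw [twist_mul ξ hξm hξf, hH h hh]

/-- The chosen representative of the coset `gH` acts on `R` like `g`, when `H` fixes `R` under the
twisted action. [folklore] -/
theorem twist_out_mk {R : A} {H : Subgroup G} (hH : ∀ h ∈ H, h • R + ξ h = R) (g : G) :
    ((g : G ⧸ H).out) • R + ξ (g : G ⧸ H).out = g • R + ξ g := by
  obtain ⟨h, hh⟩ := QuotientGroup.mk_out_eq_mul H g
  rw [hh, twist_mul_of_mem ξ hξm hξf hH g h.2]

/-- The orbit map `G ⧸ U → A`, `q ↦ q.out ⋆ R`, is injective for the full twisted stabiliser `U` of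
`R`. [folklore] -/
theorem twist_out_injective {R : A} {U : Subgroup G} (hU : ∀ g, g ∈ U ↔ g • R + ξ g = R) :
    Function.Injective fun q : G ⧸ U ↦ q.out • R + ξ q.out := by
  intro q q' h
  have h2 := congrArg (fun x ↦ q.out⁻¹ • x + ξ q.out⁻¹) h
  simp only at h2
  rw [twist_inv_twist ξ hξm hξf, ← twist_mul ξ hξm hξf] at h2
  rw [← Quotient.out_eq q, ← Quotient.out_eq q']
  exact QuotientGroup.eq.mpr ((hU _).mpr h2.symm)

/-- **The twisted orbit as a finite set.** For the full twisted stabiliser `U` of `R`, of finite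
index, the image `O` of `q ↦ q.out ⋆ R` satisfies: membership is "being of the form `g ⋆ R`", its
cardinality is `[G : U]`, and its sum is the orbit sum `∑_{q ∈ G/U} q.out ⋆ R`. [folklore] -/
theorem orbitFinset_spec {R : A} {U : Subgroup G} (hU : ∀ g, g ∈ U ↔ g • R + ξ g = R)
    [Fintype (G ⧸ U)] :
    (∀ x, x ∈ (Finset.univ.image fun q : G ⧸ U ↦ q.out • R + ξ q.out) ↔ ∃ g : G, g • R + ξ g = x) ∧
    (Finset.univ.image fun q : G ⧸ U ↦ q.out • R + ξ q.out).card = U.index ∧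
    ∑ x ∈ (Finset.univ.image fun q : G ⧸ U ↦ q.out • R + ξ q.out), x =
      ∑ q : G ⧸ U, (q.out • R + ξ q.out) := by
  have hinj := twist_out_injective ξ hξm hξf hU
  refine ⟨fun x ↦ ?_, ?_, ?_⟩
  · simp only [Finset.mem_image, Finset.mem_univ, true_and]
    constructor
    · rintro ⟨q, rfl⟩
      exact ⟨q.out, rfl⟩
    · rintro ⟨g, rfl⟩
      exact ⟨(g : G ⧸ U), twist_out_mk ξ hξm hξf (fun h hh ↦ (hU h).mp hh) g⟩
  · rw [Finset.card_image_of_injective _ hinj, Finset.card_univ, Subgroup.index_eq_card,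
      Nat.card_eq_fintype_card]
  · rw [Finset.sum_image fun q _ q' _ h ↦ hinj h]

end Twist

/-! ### The reference point `R₁`: killing the unramified character `χ₂` -/

section Specific

variable {P : ℕ} [NeZero P] (I : Subgroup G) [I.Normal] (F : G) (Op : Subgroup G → Prop)

omit [I.Normal] in
/-- **The reference point.** From a solution `z ∈ A^I` of `F z - z = -χ₂(F) T₂` (hypothesis
`hnice1`) one gets `σ z - z = -χ₂(σ) T₂` for *all* `σ`: both sides are homomorphisms in `σ`
(`P z` is fixed by `F`, `I` and the stabiliser of `z`, hence by everything, by the density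
hypothesis `hdens`), they vanish on `I` and on `Stab(z) ∩ ker χ₂`, and agree at `F`. [folklore] -/
theorem exists_shift_point
    (hOp_inf : ∀ U V, Op U → Op V → Op (U ⊓ V)) (hOp_stab : ∀ a : A, Op (MulAction.stabilizer G a))
    (hdens : ∀ U, Op U → ∀ σ : G, ∃ (n : ℕ) (i u : G), i ∈ I ∧ u ∈ U ∧ σ = F ^ n * i * u)
    (hfix : ∀ a : A, P • a = 0 → ∀ σ : G, σ • a = a)
    {T₂ : A} (hT₂ : P • T₂ = 0) (χ₂ : G → ZMod P) (hχ₂ : ∀ σ τ, χ₂ (σ * τ) = χ₂ σ + χ₂ τ)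
    (K₂ : Subgroup G) (hK₂ : ∀ g, g ∈ K₂ ↔ χ₂ g = 0) (hOpK₂ : Op K₂)
    (hIχ₂ : ∀ σ ∈ I, χ₂ σ = 0)
    (hnice1 : ∀ a : A, P • a = 0 → ∃ z : A, (∀ σ ∈ I, σ • z = z) ∧ F • z - z = a) :
    ∃ R₁ : A, (∀ σ ∈ I, σ • R₁ = R₁) ∧ ∀ σ : G, σ • R₁ - R₁ = -((χ₂ σ).val • T₂) := by
  obtain ⟨z, hzI, hzF⟩ := hnice1 (-((χ₂ F).val • T₂))
    (by rw [neg_nsmul, nsmul_nsmul_eq_zero hT₂, neg_zero])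
  -- `P • z` is fixed by everything
  have hF1 : F • (P • z) = P • z := by
    rw [smul_comm (M := G) (N := ℕ), (sub_eq_iff_eq_add.mp hzF), nsmul_add, neg_nsmul,
      nsmul_nsmul_eq_zero hT₂, neg_zero, zero_add]
  have hFn : ∀ n : ℕ, F ^ n • (P • z) = P • z := by
    intro n
    induction n with
    | zero => rw [pow_zero, one_smul]
    | succ k ih => rw [pow_succ', mul_smul, ih, hF1]
  have hPz : ∀ σ : G, σ • (P • z) = P • z := by
    intro σ
    obtain ⟨n, i, u, hi, hu, rfl⟩ := hdens _ (hOp_stab z) σ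
    rw [mul_smul, mul_smul, smul_comm (N := ℕ) u, MulAction.mem_stabilizer_iff.mp hu,
      smul_comm (N := ℕ) i, hzI i hi, hFn]
  have hc0 : ∀ σ : G, P • (σ • z - z) = 0 := fun σ ↦ by
    rw [nsmul_sub, ← smul_comm (M := G) (N := ℕ), hPz, sub_self]
  have hcfix : ∀ σ τ : G, τ • (σ • z - z) = σ • z - z := fun σ τ ↦ hfix _ (hc0 σ) τ
  have hcmul : ∀ σ τ : G, (σ * τ) • z - z = (σ • z - z) + (τ • z - z) := by
    intro σ τ
    have e : τ • z = (τ • z - z) + z := (sub_add_cancel _ _).symm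
    conv_lhs => rw [mul_smul, e, smul_add, hcfix]
    abel
  have hcpow : ∀ n : ℕ, F ^ n • z - z = n • (F • z - z) := by
    intro n
    induction n with
    | zero => rw [pow_zero, one_smul, sub_self, zero_nsmul]
    | succ k ih => rw [pow_succ, hcmul, ih, succ_nsmul]
  refine ⟨z, hzI, fun σ ↦ ?_⟩
  obtain ⟨n, i, u, hi, hu, rfl⟩ := hdens _ (hOp_inf _ _ (hOp_stab z) hOpK₂) σ
  rw [Subgroup.mem_inf, MulAction.mem_stabilizer_iff, hK₂] at hu
  rw [hcmul, hcmul, hcpow, hzF, hzI i hi, sub_self, add_zero, hu.1, sub_self, add_zero,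
    hχ₂, hχ₂, char_pow χ₂ hχ₂, hIχ₂ i hi, add_zero, hu.2, add_zero, val_nsmul_nsmul hT₂, neg_nsmul]

/-! ### Nice points: `I`-invariant points of the `χ₁`-torsor over a given splitting group -/

omit [I.Normal] in
/-- **Elements of `H ∩ I` fix `z` and lie in `ker χ₁`**, for the stabiliser `H` of `z` under the
`χ₁`-twisted action `σ ⋆ z = σ z + χ₁(σ) T₁`: `P z` is `H`-invariant, so an element of `H ∩ I`
moves `z` by a `P`-torsion element, hence fixes it (hypothesis `hunr`: "`P`-division points of
invariants are fixed by inertia"), and then `χ₁(σ) T₁ = 0`. [folklore] -/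
theorem smul_eq_and_char_eq_zero_of_mem_inf
    {T₁ : A} (hT₁ : P • T₁ = 0) (hT₁P : ∀ m : ℕ, m • T₁ = 0 → P ∣ m)
    (χ₁ : G → ZMod P)
    (hunr : ∀ (a : A) (σ : G), σ ∈ I → P • (σ • a - a) = 0 → σ • a = a)
    {z : A} {H : Subgroup G} (hH : ∀ g, g ∈ H ↔ g • z + (χ₁ g).val • T₁ = z)
    {g : G} (hgH : g ∈ H) (hgI : g ∈ I) : g • z = z ∧ χ₁ g = 0 := by
  have hgz : g • z = z - (χ₁ g).val • T₁ := eq_sub_of_add_eq ((hH g).mp hgH)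
  have h1 : P • (g • z - z) = 0 := by
    rw [hgz, sub_sub_cancel_left, neg_nsmul, nsmul_nsmul_eq_zero hT₁, neg_zero]
  have h2 : g • z = z := hunr z g hgI h1
  refine ⟨h2, ?_⟩
  rw [h2, eq_comm, sub_eq_self] at hgz
  exact (ZMod.val_eq_zero _).mp (Nat.eq_zero_of_dvd_of_lt (hT₁P _ hgz) (ZMod.val_lt _))

/-- In a group with a normal subgroup `I`, `(g i)^m = g^m j` for some `j ∈ I`. [folklore] -/
theorem exists_mem_pow_mul_eq (g : G) {i : G} (hi : i ∈ I) (m : ℕ) :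
    ∃ j ∈ I, (g * i) ^ m = g ^ m * j := by
  induction m with
  | zero => exact ⟨1, I.one_mem, by rw [pow_zero, pow_zero, one_mul]⟩
  | succ k ih =>
    obtain ⟨j, hj, hjk⟩ := ih
    refine ⟨g⁻¹ * j * g * i, I.mul_mem ?_ hi, ?_⟩
    · have := ‹I.Normal›.conj_mem j hj g⁻¹
      rwa [inv_inv] at this
    · rw [pow_succ, hjk, pow_succ]
      group

/-- A subgroup of finite index contains a positive power of any element. [folklore] -/
theorem exists_pos_pow_mem (L : Subgroup G) [L.FiniteIndex] (g : G) : ∃ n, 0 < n ∧ g ^ n ∈ L := by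
  obtain ⟨a, b, hab, heq⟩ :=
    Finite.exists_ne_map_eq_of_infinite (fun n : ℕ ↦ ((g ^ n : G) : G ⧸ L))
  rcases lt_or_gt_of_ne hab with h | h
  · refine ⟨b - a, Nat.sub_pos_of_lt h, ?_⟩
    have e : (g ^ a)⁻¹ * g ^ b = g ^ (b - a) := by
      rw [inv_mul_eq_iff_eq_mul, pow_mul_pow_sub g h.le]
    rw [← e]
    exact QuotientGroup.eq.mp heq
  · refine ⟨a - b, Nat.sub_pos_of_lt h, ?_⟩
    have e : (g ^ b)⁻¹ * g ^ a = g ^ (a - b) := by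
      rw [inv_mul_eq_iff_eq_mul, pow_mul_pow_sub g h.le]
    rw [← e]
    exact QuotientGroup.eq.mp heq.symm

/-- **Frobenius data of a splitting group.** For `H` of finite index containing an `Op`
subgroup and `L = H I`: the least positive exponent `f₀` with `F^{f₀} ∈ L`, a decomposition
`F^{f₀} = h₀ i₀`, the divisibility `F^n ∈ L → f₀ ∣ n`, and `[G : L] = f₀` (every coset of `L` is
some `F^n L` by the density hypothesis, and `n ↦ F^n L` is injective on `[0, f₀)`); in the
arithmetic application `f₀` is the residue degree of the fixed field of `H`. [folklore] -/
theorem exists_frobeniusData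
    (hdens : ∀ U, Op U → ∀ σ : G, ∃ (n : ℕ) (i u : G), i ∈ I ∧ u ∈ U ∧ σ = F ^ n * i * u)
    {H : Subgroup G} [H.FiniteIndex] {U₀ : Subgroup G} (hU₀ : Op U₀) (hU₀H : U₀ ≤ H) :
    ∃ f₀ : ℕ, 0 < f₀ ∧ (∀ n, F ^ n ∈ H ⊔ I → f₀ ∣ n) ∧ (H ⊔ I).index = f₀ ∧
      ∃ h₀ ∈ H, ∃ i₀ ∈ I, h₀ * i₀ = F ^ f₀ := by
  haveI : (H ⊔ I).FiniteIndex := Subgroup.finiteIndex_of_le le_sup_left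
  have hex : ∃ n, 0 < n ∧ F ^ n ∈ H ⊔ I := exists_pos_pow_mem (H ⊔ I) F
  have hf₀pos : 0 < Nat.find hex := (Nat.find_spec hex).1
  have hf₀L : F ^ Nat.find hex ∈ H ⊔ I := (Nat.find_spec hex).2
  have hf₀min : ∀ n, F ^ n ∈ H ⊔ I → Nat.find hex ∣ n := by
    intro n hn
    have hr : F ^ (n % Nat.find hex) ∈ H ⊔ I := by
      have e : F ^ (n % Nat.find hex) = ((F ^ Nat.find hex) ^ (n / Nat.find hex))⁻¹ * F ^ n := by
        rw [eq_inv_mul_iff_mul_eq, ← pow_mul, ← pow_add, Nat.div_add_mod]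
      rw [e]
      exact (H ⊔ I).mul_mem ((H ⊔ I).inv_mem ((H ⊔ I).pow_mem hf₀L _)) hn
    by_contra hnd
    have hpos : 0 < n % Nat.find hex := Nat.pos_of_ne_zero fun h0 ↦ hnd (Nat.dvd_of_mod_eq_zero h0)
    exact Nat.find_min hex (Nat.mod_lt n hf₀pos) ⟨hpos, hr⟩
  have hmem : (F ^ Nat.find hex : G) ∈ (H : Set G) * (I : Set G) := by
    rw [← Subgroup.mul_normal H I]
    exact hf₀L
  obtain ⟨h₀, hh₀, i₀, hi₀, hhi⟩ := Set.mem_mul.mp hmem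
  refine ⟨Nat.find hex, hf₀pos, hf₀min, ?_, h₀, hh₀, i₀, hi₀, hhi⟩
  -- `[G : L] = f₀`
  letI : Fintype (G ⧸ (H ⊔ I)) := Fintype.ofFinite _
  rw [Subgroup.index_eq_card, Nat.card_eq_fintype_card, ← Fintype.card_fin (Nat.find hex)]
  refine (Fintype.card_of_bijective (f := fun n : Fin (Nat.find hex) ↦ ((F ^ (n : ℕ) : G) : G ⧸ (H ⊔ I)))
    ⟨?_, ?_⟩).symm
  · intro a b hab
    simp only at hab
    rcases lt_trichotomy (a : ℕ) b with h | h | h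
    · exfalso
      have hmemab : F ^ ((b : ℕ) - a) ∈ H ⊔ I := by
        have e : (F ^ (a : ℕ))⁻¹ * F ^ (b : ℕ) = F ^ ((b : ℕ) - a) := by
          rw [inv_mul_eq_iff_eq_mul, pow_mul_pow_sub F h.le]
        rw [← e]
        exact QuotientGroup.eq.mp hab
      have h1 := Nat.le_of_dvd (Nat.sub_pos_of_lt h) (hf₀min _ hmemab)
      have h2 : (b : ℕ) - a < Nat.find hex := lt_of_le_of_lt (Nat.sub_le _ _) b.2
      exact absurd h1 (not_le.mpr h2)
    · exact Fin.ext h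
    · exfalso
      have hmemab : F ^ ((a : ℕ) - b) ∈ H ⊔ I := by
        have e : (F ^ (b : ℕ))⁻¹ * F ^ (a : ℕ) = F ^ ((a : ℕ) - b) := by
          rw [inv_mul_eq_iff_eq_mul, pow_mul_pow_sub F h.le]
        rw [← e]
        exact QuotientGroup.eq.mp hab.symm
      have h1 := Nat.le_of_dvd (Nat.sub_pos_of_lt h) (hf₀min _ hmemab)
      have h2 : (a : ℕ) - b < Nat.find hex := lt_of_le_of_lt (Nat.sub_le _ _) a.2
      exact absurd h1 (not_le.mpr h2)
  · intro Q
    induction Q using QuotientGroup.induction_on with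
    | H σ =>
      obtain ⟨n, i, u, hi, hu, rfl⟩ := hdens _ hU₀ σ
      refine ⟨⟨n % Nat.find hex, Nat.mod_lt n hf₀pos⟩, ?_⟩
      simp only
      apply QuotientGroup.eq.mpr
      -- `(F ^ (n % f₀))⁻¹ * (F ^ n * i * u) ∈ H ⊔ I`
      have e : (F ^ (n % Nat.find hex))⁻¹ * (F ^ n * i * u) =
          (F ^ Nat.find hex) ^ (n / Nat.find hex) * (i * u) := by
        rw [inv_mul_eq_iff_eq_mul, ← mul_assoc, ← mul_assoc, ← pow_mul, ← pow_add,
          Nat.mod_add_div]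
      rw [e]
      exact (H ⊔ I).mul_mem ((H ⊔ I).pow_mem hf₀L _)
        ((H ⊔ I).mul_mem (Subgroup.mem_sup_right hi) (Subgroup.mem_sup_left (hU₀H hu)))

/-- **Existence of nice points.** Let `H` be the stabiliser of `z` for the `χ₁`-twisted action,
`L = H I`, `f₀` the least positive exponent with `F^{f₀} ∈ L`, `F^{f₀} = h₀ i₀`
(`exists_frobeniusData`). A solution `w ∈ A^I` of `F^{f₀} w - w = -χ₁(h₀) T₁` (hypothesis
`hnice`) is an `I`-invariant point of the `χ₁`-torsor over the fixed field of `H`: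
`h w - w = -χ₁(h) T₁` for all `h ∈ H`. Indeed `h = F^{f₀ m} i u = h₀^m · i'' · u` with
`i'' ∈ H ∩ I` (so `χ₁(i'') = 0`, `smul_eq_and_char_eq_zero_of_mem_inf`) and `u` in the
stabiliser of `z` and `w` inside `ker χ₁` (density hypothesis `hdens`). This replaces Lang's
theorem over the unramified extension cut out by `L`. [folklore] -/
theorem exists_nicePoint
    (hOp_inf : ∀ U V, Op U → Op V → Op (U ⊓ V)) (hOp_stab : ∀ a : A, Op (MulAction.stabilizer G a))
    (hdens : ∀ U, Op U → ∀ σ : G, ∃ (n : ℕ) (i u : G), i ∈ I ∧ u ∈ U ∧ σ = F ^ n * i * u)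
    {T₁ : A} (hT₁ : P • T₁ = 0) (hT₁P : ∀ m : ℕ, m • T₁ = 0 → P ∣ m) (hT₁fix : ∀ σ : G, σ • T₁ = T₁)
    (χ₁ : G → ZMod P) (hχ₁ : ∀ σ τ, χ₁ (σ * τ) = χ₁ σ + χ₁ τ)
    (K₁ : Subgroup G) (hK₁ : ∀ g, g ∈ K₁ ↔ χ₁ g = 0) (hOpK₁ : Op K₁)
    (hunr : ∀ (a : A) (σ : G), σ ∈ I → P • (σ • a - a) = 0 → σ • a = a)
    (hnice : ∀ f : ℕ, 0 < f → ∀ a : A, P • a = 0 → ∃ z : A, (∀ σ ∈ I, σ • z = z) ∧ F ^ f • z - z = a)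
    {z : A} {H : Subgroup G} (hH : ∀ g, g ∈ H ↔ g • z + (χ₁ g).val • T₁ = z)
    {f₀ : ℕ} (hf₀pos : 0 < f₀) (hf₀min : ∀ n, F ^ n ∈ H ⊔ I → f₀ ∣ n)
    {h₀ i₀ : G} (hh₀ : h₀ ∈ H) (hi₀ : i₀ ∈ I) (hhi : h₀ * i₀ = F ^ f₀) :
    ∃ w : A, (∀ σ ∈ I, σ • w = w) ∧ ∀ h ∈ H, h • w - w = -((χ₁ h).val • T₁) := by
  have hU₀H : MulAction.stabilizer G z ⊓ K₁ ≤ H := fun g hg ↦ by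
    rw [Subgroup.mem_inf, MulAction.mem_stabilizer_iff, hK₁] at hg
    rw [hH, hg.1, hg.2, ZMod.val_zero, zero_nsmul, add_zero]
  have hHI : ∀ g, g ∈ H → g ∈ I → g • z = z ∧ χ₁ g = 0 := fun g hgH hgI ↦
    smul_eq_and_char_eq_zero_of_mem_inf I hT₁ hT₁P χ₁ hunr hH hgH hgI
  -- the nice point
  obtain ⟨w, hwI, hwF⟩ := hnice f₀ hf₀pos (-((χ₁ h₀).val • T₁))
    (by rw [neg_nsmul, nsmul_nsmul_eq_zero hT₁, neg_zero])
  refine ⟨w, hwI, fun h hh ↦ ?_⟩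
  have hh₀w : h₀ • w = w + -((χ₁ h₀).val • T₁) := by
    have hwF' := hwF
    rw [← hhi, mul_smul, hwI _ hi₀] at hwF'
    exact sub_eq_iff_eq_add'.mp hwF'
  have hafix : ∀ σ : G, σ • (-((χ₁ h₀).val • T₁)) = -((χ₁ h₀).val • T₁) := fun σ ↦ by
    rw [smul_neg, smul_comm (M := G) (N := ℕ), hT₁fix]
  have hpow : ∀ m : ℕ, h₀ ^ m • w = w + m • (-((χ₁ h₀).val • T₁)) := by
    intro m
    induction m with
    | zero => rw [pow_zero, one_smul, zero_nsmul, add_zero]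
    | succ k ih =>
      rw [pow_succ', mul_smul, ih, smul_add, hh₀w, smul_comm (M := G) (N := ℕ), hafix, succ_nsmul]
      abel
  -- decompose `h`
  obtain ⟨n, i, u, hi, hu, hdec⟩ :=
    hdens _ (hOp_inf _ _ (hOp_inf _ _ (hOp_stab z) hOpK₁) (hOp_stab w)) h
  have hu' := hu
  rw [Subgroup.mem_inf, MulAction.mem_stabilizer_iff] at hu'
  have huH : u ∈ H := hU₀H hu'.1
  have huK : χ₁ u = 0 := by
    have := hu'.1
    rw [Subgroup.mem_inf, hK₁] at this
    exact this.2
  have hFn : F ^ n ∈ H ⊔ I := by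
    have e1 : F ^ n = h * u⁻¹ * i⁻¹ := by rw [hdec]; group
    rw [e1]
    exact Subgroup.mul_mem_sup (H.mul_mem hh (H.inv_mem huH)) (I.inv_mem hi)
  obtain ⟨m, hm⟩ := hf₀min n hFn
  obtain ⟨j, hj, hjm⟩ := exists_mem_pow_mul_eq I h₀ hi₀ m
  -- `F ^ n = h₀ ^ m * j`
  have hFfm : F ^ n = h₀ ^ m * j := by rw [hm, pow_mul, ← hhi, hjm]
  have hjiH : j * i ∈ H := by
    have e : j * i = (h₀ ^ m)⁻¹ * h * u⁻¹ := by rw [hdec, hFfm]; group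
    rw [e]
    exact H.mul_mem (H.mul_mem (H.inv_mem (H.pow_mem hh₀ m)) hh) (H.inv_mem huH)
  have hjiI : j * i ∈ I := I.mul_mem hj hi
  obtain ⟨-, hχji⟩ := hHI _ hjiH hjiI
  have hgrp : h = h₀ ^ m * (j * i) * u := by rw [hdec, hFfm]; group
  have hw1 : h • w = w + m • (-((χ₁ h₀).val • T₁)) := by
    rw [hgrp, mul_smul, mul_smul, hu'.2, hwI _ hjiI, hpow]
  have hχh : χ₁ h = m • χ₁ h₀ := by
    rw [hgrp, hχ₁, hχ₁, char_pow χ₁ hχ₁, hχji, huK, add_zero, add_zero]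
  rw [hw1, add_sub_cancel_left, hχh, val_nsmul_nsmul hT₁, neg_nsmul]

/-! ### The orbit sum of a nice point -/

omit [NeZero P] [I.Normal] in
/-- **`χ₁` is well defined on `I`-parts**: if `h i = h' i'` with `h, h' ∈ H`, `i, i' ∈ I` and `χ₁`
vanishes on `H ∩ I`, then `χ₁ i = χ₁ i'`. [folklore] -/
theorem char_eq_of_mul_eq_mul (χ₁ : G → ZMod P) (hχ₁ : ∀ σ τ, χ₁ (σ * τ) = χ₁ σ + χ₁ τ)
    {H : Subgroup G} (hHI : ∀ g, g ∈ H → g ∈ I → χ₁ g = 0) {h h' i i' : G} (hh : h ∈ H)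
    (hh' : h' ∈ H) (hi : i ∈ I) (hi' : i' ∈ I) (he : h * i = h' * i') : χ₁ i = χ₁ i' := by
  have e : h'⁻¹ * h = i' * i⁻¹ := by
    rw [inv_mul_eq_iff_eq_mul, ← mul_inv_eq_iff_eq_mul.mpr he.symm]
    group
  have hmem : i' * i⁻¹ ∈ H := by
    rw [← e]
    exact H.mul_mem (H.inv_mem hh') hh
  have h0 := hHI _ hmem (I.mul_mem hi' (I.inv_mem hi))
  rw [hχ₁, char_inv χ₁ hχ₁, ← sub_eq_add_neg, sub_eq_zero] at h0
  exact h0.symm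

/-- `∑_{c ∈ ℤ/P} c.val = P (P - 1) / 2`. [folklore] -/
theorem sum_val_zmod : ∑ c : ZMod P, c.val = P * (P - 1) / 2 := by
  rw [← Finset.sum_range_id]
  refine Finset.sum_nbij (fun c : ZMod P ↦ c.val) (fun c _ ↦ Finset.mem_range.mpr (ZMod.val_lt c))
    (fun c _ c' _ h ↦ ZMod.val_injective P h) (fun k hk ↦ ?_) (fun _ _ ↦ rfl)
  rw [Finset.coe_range, Set.mem_Iio] at hk
  exact ⟨(k : ZMod P), Finset.mem_coe.mpr (Finset.mem_univ _), by
    simp only [ZMod.val_natCast, Nat.mod_eq_of_lt hk]⟩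

/-- **The orbit sum of a nice point.** Let `w ∈ A^I` with `h w - w = -χ₁(h) T₁` for `h ∈ H`
(`[G : H] < ∞`), `L = H I`. The fibres of `G/H → G/L` are `I`-orbits, on which the
`χ₁`-twisted action is translation by the values of `χ₁` (each value of `ℤ/P` taken equally
often, `χ₁|_I` being onto and `χ₁` vanishing on `H ∩ I`); so `P ∣ [G : H]`, the orbit sum
`∑_{q ∈ G/H} q.out ⋆ w` is `P · (explicit) + ([G:H]/P) · (P(P-1)/2) T₁`, and for the resulting
`P`-th root `s` one has `F s - s ∈ ℤ T₁`. [folklore] -/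
theorem exists_root_niceOrbitSum
    {T₁ : A} (hT₁ : P • T₁ = 0) (hT₁fix : ∀ σ : G, σ • T₁ = T₁)
    (χ₁ : G → ZMod P) (hχ₁ : ∀ σ τ, χ₁ (σ * τ) = χ₁ σ + χ₁ τ)
    (hIχ₁ : ∀ c : ZMod P, ∃ σ ∈ I, χ₁ σ = c)
    (hjunk : ∃ c : A, (∀ σ : G, σ • c = c) ∧ P • c = (P * (P - 1) / 2) • T₁)
    {w : A} (hwI : ∀ σ ∈ I, σ • w = w) {H : Subgroup G} [H.FiniteIndex]
    (hHw : ∀ h ∈ H, h • w - w = -((χ₁ h).val • T₁))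
    (hHI : ∀ g, g ∈ H → g ∈ I → χ₁ g = 0) [Fintype (G ⧸ H)] :
    (∃ N₀ : ℕ, H.relIndex (H ⊔ I) = P * N₀) ∧
      ∃ s : A, P • s = ∑ q : G ⧸ H, (q.out • w + (χ₁ q.out).val • T₁) ∧
        ∃ m : ℤ, F • s - s = m • T₁ := by
  -- set-up: `L = H ⊔ I` and the finiteness instances
  set L : Subgroup G := H ⊔ I with hL
  have hHL : H ≤ L := le_sup_left
  haveI : L.FiniteIndex := Subgroup.finiteIndex_of_le hHL
  haveI : (H.subgroupOf L).FiniteIndex := ⟨by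
    change H.relIndex L ≠ 0
    intro h0
    have h1 := Subgroup.relIndex_mul_index hHL
    rw [h0, zero_mul] at h1
    exact Subgroup.FiniteIndex.index_ne_zero h1.symm⟩
  letI : Fintype (G ⧸ L) := Fintype.ofFinite _
  letI : Fintype (L ⧸ H.subgroupOf L) := Fintype.ofFinite _
  obtain ⟨c, hcfix, hcP⟩ := hjunk
  -- the summand and its invariances
  set f : G → A := fun g ↦ g • w + (χ₁ g).val • T₁ with hf
  have hHw' : ∀ h ∈ H, h • w = w + -((χ₁ h).val • T₁) := fun h hh ↦ sub_eq_iff_eq_add'.mp (hHw h hh)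
  have hfH : ∀ g, ∀ h ∈ H, f (g * h) = f g := by
    intro g h hh
    simp only [hf]
    rw [mul_smul, hHw' h hh, smul_add, smul_neg, smul_comm (M := G) (N := ℕ), hT₁fix, hχ₁,
      val_add_nsmul hT₁]
    abel
  have hdecomp : ∀ y : L, ∃ h ∈ H, ∃ i ∈ I, h * i = y := fun y ↦ by
    have hy : (y : G) ∈ (H : Set G) * (I : Set G) := by
      rw [← Subgroup.mul_normal H I]
      exact y.2
    obtain ⟨h, hh, i, hi, e⟩ := Set.mem_mul.mp hy
    exact ⟨h, hh, i, hi, e⟩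
  choose hy hhy iy hiy heq using hdecomp
  have hfL : ∀ (g : G) (y : L), f (g * y) = f g + (χ₁ (iy y)).val • T₁ := by
    intro g y
    simp only [hf]
    rw [← heq y, ← mul_assoc, mul_smul, mul_smul, hwI _ (hiy y), hHw' _ (hhy y), smul_add, smul_neg,
      smul_comm (M := G) (N := ℕ), hT₁fix, hχ₁, hχ₁, val_add_nsmul hT₁, val_add_nsmul hT₁]
    abel
  -- the regrouped orbit sum
  have hS : ∑ q : G ⧸ H, f q.out = (Fintype.card (L ⧸ H.subgroupOf L)) • ∑ Q : G ⧸ L, f Q.out +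
      (Fintype.card (G ⧸ L)) • ∑ r : L ⧸ H.subgroupOf L, (χ₁ (iy r.out)).val • T₁ := by
    rw [sum_quotient_eq_sum_sum hHL f hfH]
    have step : ∀ Q : G ⧸ L, ∑ r : L ⧸ H.subgroupOf L, f (Q.out * r.out) =
        (Fintype.card (L ⧸ H.subgroupOf L)) • f Q.out +
          ∑ r : L ⧸ H.subgroupOf L, (χ₁ (iy r.out)).val • T₁ := by
      intro Q
      simp_rw [hfL]
      rw [Finset.sum_add_distrib, Finset.sum_const, Finset.card_univ]
    simp_rw [step]
    rw [Finset.sum_add_distrib, Finset.sum_const, Finset.card_univ, ← Finset.smul_sum]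
  -- equidistribution of `δ r = χ₁ (iy r.out)` on `L ⧸ H`
  have hIL : ∀ i ∈ I, i ∈ L := fun i hi ↦ Subgroup.mem_sup_right hi
  have htrans : ∀ (i₁ : G) (hi₁ : i₁ ∈ I) (r : L ⧸ H.subgroupOf L),
      χ₁ (iy ((⟨i₁, hIL i₁ hi₁⟩ : L) • r).out) = χ₁ i₁ + χ₁ (iy r.out) := by
    intro i₁ hi₁ r
    obtain ⟨k, hk⟩ := QuotientGroup.mk_out_eq_mul (H.subgroupOf L) ((⟨i₁, hIL i₁ hi₁⟩ : L) • r.out)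
    rw [MulAction.Quotient.coe_smul_out, smul_eq_mul] at hk
    -- two decompositions of `X = (t • r).out`
    set kG : G := ((k : L) : G) with hkG
    have hX : (hy ((⟨i₁, hIL i₁ hi₁⟩ : L) • r).out) * (iy ((⟨i₁, hIL i₁ hi₁⟩ : L) • r).out) =
        (hy r.out * kG) * (kG⁻¹ * ((hy r.out)⁻¹ * i₁ * hy r.out) * iy r.out * kG) := by
      rw [heq, hk]
      have e2 : ((r.out : L) : G) = hy r.out * iy r.out := (heq r.out).symm
      simp only [Subgroup.coe_mul, e2, hkG]
      group
    have hkH : kG ∈ H := k.2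
    have hiI : kG⁻¹ * ((hy r.out)⁻¹ * i₁ * hy r.out) * iy r.out * kG ∈ I := by
      have h1 : (hy r.out)⁻¹ * i₁ * hy r.out ∈ I := by
        have := ‹I.Normal›.conj_mem i₁ hi₁ (hy r.out)⁻¹
        rwa [inv_inv] at this
      have h2 : (hy r.out)⁻¹ * i₁ * hy r.out * iy r.out ∈ I := I.mul_mem h1 (hiy _)
      have := ‹I.Normal›.conj_mem _ h2 kG⁻¹
      rw [inv_inv] at this
      simpa only [mul_assoc] using this
    rw [char_eq_of_mul_eq_mul I χ₁ hχ₁ hHI (hhy _) (H.mul_mem (hhy _) hkH) (hiy _) hiI hX]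
    simp only [hχ₁, char_inv χ₁ hχ₁]
    abel
  -- all fibres of `δ` have the same cardinality `N₀`
  set N₀ := (Finset.univ.filter fun r : L ⧸ H.subgroupOf L ↦ χ₁ (iy r.out) = 0).card with hN₀
  have hfib : ∀ c₀ : ZMod P,
      (Finset.univ.filter fun r : L ⧸ H.subgroupOf L ↦ χ₁ (iy r.out) = c₀).card = N₀ := by
    intro c₀
    obtain ⟨i₁, hi₁, hχi₁⟩ := hIχ₁ c₀
    set t : L := ⟨i₁, hIL i₁ hi₁⟩ with ht
    have himg : (Finset.univ.filter fun r : L ⧸ H.subgroupOf L ↦ χ₁ (iy r.out) = c₀) =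
        (Finset.univ.filter fun r : L ⧸ H.subgroupOf L ↦ χ₁ (iy r.out) = 0).image (t • ·) := by
      ext r
      simp only [Finset.mem_filter, Finset.mem_univ, true_and, Finset.mem_image]
      constructor
      · intro hr
        refine ⟨t⁻¹ • r, ?_, smul_inv_smul t r⟩
        have := htrans i₁ hi₁ (t⁻¹ • r)
        rw [← ht, smul_inv_smul, hr, hχi₁] at this
        exact (add_eq_left.mp this.symm)
      · rintro ⟨r', hr', rfl⟩
        rw [htrans i₁ hi₁ r', hr', add_zero, hχi₁]
    rw [himg, Finset.card_image_of_injective _ (MulAction.injective t)]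
  have hcardLH : Fintype.card (L ⧸ H.subgroupOf L) = P * N₀ := by
    rw [← Finset.card_univ, Finset.card_eq_sum_card_fiberwise
      (f := fun r : L ⧸ H.subgroupOf L ↦ χ₁ (iy r.out)) (t := Finset.univ)
      (fun _ _ ↦ Finset.mem_coe.mpr (Finset.mem_univ _))]
    simp_rw [hfib]
    rw [Finset.sum_const, Finset.card_univ, ZMod.card, smul_eq_mul]
  have hJ : ∑ r : L ⧸ H.subgroupOf L, (χ₁ (iy r.out)).val • T₁ = N₀ • ((P * (P - 1) / 2) • T₁) := by
    rw [← Finset.sum_fiberwise' Finset.univ (fun r : L ⧸ H.subgroupOf L ↦ χ₁ (iy r.out))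
      (fun c₀ : ZMod P ↦ c₀.val • T₁)]
    simp_rw [Finset.sum_const, hfib]
    rw [← Finset.smul_sum, ← Finset.sum_smul, sum_val_zmod]
  -- the index
  have hindex : H.index = Fintype.card (G ⧸ L) * (P * N₀) := by
    rw [Subgroup.index_eq_card, Nat.card_eq_fintype_card,
      Fintype.card_congr (Subgroup.quotientEquivProdOfLE hHL), Fintype.card_prod, hcardLH]
  refine ⟨⟨N₀, by rw [Subgroup.relIndex, Subgroup.index_eq_card, Nat.card_eq_fintype_card, hcardLH]⟩, ?_⟩
  -- the root
  set X : A := ∑ Q : G ⧸ L, f Q.out with hXdef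
  refine ⟨N₀ • X + (Fintype.card (G ⧸ L) * N₀) • c, ?_, ?_⟩
  · change _ = ∑ q : G ⧸ H, f q.out
    have e1 : P • (N₀ • X) = (P * N₀) • X := (mul_nsmul' X P N₀).symm
    have e2 : P • ((Fintype.card (G ⧸ L) * N₀) • c) =
        Fintype.card (G ⧸ L) • (N₀ • ((P * (P - 1) / 2) • T₁)) := by
      rw [← mul_nsmul', mul_comm, mul_nsmul', hcP, mul_nsmul']
    rw [hS, hJ, hcardLH, nsmul_add, e1, e2]
  · -- `F • s - s ∈ ℤ T₁`
    have e1 : F • (N₀ • X + (Fintype.card (G ⧸ L) * N₀) • c) - (N₀ • X + (Fintype.card (G ⧸ L) * N₀) • c)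
        = N₀ • (F • X - X) := by
      rw [smul_add, smul_comm (N := ℕ) F, smul_comm (N := ℕ) F, hcfix, nsmul_sub]
      abel
    have hFf : ∀ g, F • f g = f (F * g) - (χ₁ F).val • T₁ := by
      intro g
      simp only [hf]
      rw [mul_smul, smul_add, smul_comm (M := G) (N := ℕ), hT₁fix, hχ₁, val_add_nsmul hT₁]
      abel
    have hout : ∀ Q : G ⧸ L, ∃ y ∈ L, (F • Q).out = F * Q.out * y := exists_smul_out_eq L F
    choose yQ hyQ hyQeq using hout
    have hX : F • X - X =
        ∑ Q : G ⧸ L, (((χ₁ (iy ⟨(yQ Q)⁻¹, L.inv_mem (hyQ Q)⟩)).val : ℤ) - (χ₁ F).val) • T₁ := by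
      rw [hXdef, Finset.smul_sum, ← Finset.sum_sub_distrib]
      have hterm : ∀ Q : G ⧸ L, F • f Q.out - f Q.out = (f (F • Q).out - f Q.out) +
          (((χ₁ (iy ⟨(yQ Q)⁻¹, L.inv_mem (hyQ Q)⟩)).val : ℤ) - (χ₁ F).val) • T₁ := by
        intro Q
        have e : F * Q.out = (F • Q).out * ((⟨(yQ Q)⁻¹, L.inv_mem (hyQ Q)⟩ : L) : G) := by
          change F * Q.out = (F • Q).out * (yQ Q)⁻¹
          rw [hyQeq, mul_inv_cancel_right]
        rw [hFf, e, hfL, sub_smul, natCast_zsmul, natCast_zsmul]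
        abel
      simp_rw [hterm]
      rw [Finset.sum_add_distrib, Finset.sum_sub_distrib,
        Fintype.sum_bijective (fun Q : G ⧸ L ↦ F • Q) (MulAction.bijective F)
          (fun Q : G ⧸ L ↦ f (F • Q).out) (fun Q : G ⧸ L ↦ f Q.out) (fun _ ↦ rfl), sub_self, zero_add]
    refine ⟨(N₀ : ℤ) * (∑ Q : G ⧸ L, ((((χ₁ (iy ⟨(yQ Q)⁻¹, L.inv_mem (hyQ Q)⟩)).val : ℤ) -
      (χ₁ F).val))), ?_⟩
    rw [e1, hX, ← Finset.sum_smul, ← natCast_zsmul, smul_smul]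

/-! ### The norm part: a transfer computation -/

omit [NeZero P] in
/-- **The norm part of an orbit sum has an `F`-invariant `P`-th root (transfer argument).** Let
`u ∈ A^H`, `P ut = u`, `κ(h) = h ut - ut` (`h ∈ H`; values in `A[P]`, so `κ` is additive on
`H`); `κ` kills `H ∩ I` (hypothesis `hunr`) and an `Op` normal subgroup `N ≤ H` fixing `ut`.
Then `F · Ñ - Ñ = ∑_q κ(y_q⁻¹)` for the root `Ñ = ∑_{q ∈ G/H} q.out • ut` of the norm
`∑ q.out • u` and the Schreier elements `y_q`, i.e. `κ` of the transfer of `F`; modulo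
`M = I N` every element is a power of `F` (density), the Schreier elements multiply to `F^{[G:H]}`
modulo `M`, and `[G : H] = f₀ · P N₀` with `F^{f₀} ≡ h₀ ∈ H`, so the sum is
`P N₀ · κ(h₀) = 0`. [folklore] -/
theorem smul_normRoot_sub_self
    (hdens : ∀ U, Op U → ∀ σ : G, ∃ (n : ℕ) (i u : G), i ∈ I ∧ u ∈ U ∧ σ = F ^ n * i * u)
    (hfix : ∀ a : A, P • a = 0 → ∀ σ : G, σ • a = a)
    (hunr : ∀ (a : A) (σ : G), σ ∈ I → P • (σ • a - a) = 0 → σ • a = a)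
    {H : Subgroup G} [Fintype (G ⧸ H)]
    {u : A} (hu : ∀ h ∈ H, h • u = u) {ut : A} (hut : P • ut = u)
    {N : Subgroup G} [N.Normal] (hNH : N ≤ H) (hNut : ∀ n ∈ N, n • ut = ut) (hOpN : Op N)
    {h₀ i₀ : G} (hh₀ : h₀ ∈ H) (hi₀ : i₀ ∈ I) {f₀ N₀ : ℕ} (hhi : h₀ * i₀ = F ^ f₀)
    (hindex : Fintype.card (G ⧸ H) = f₀ * (P * N₀)) :
    F • (∑ q : G ⧸ H, q.out • ut) - ∑ q : G ⧸ H, q.out • ut = 0 := by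
  -- the cocycle `κ h = h • ut - ut` on `H`
  have hκP : ∀ h ∈ H, P • (h • ut - ut) = 0 := fun h hh ↦ by
    rw [nsmul_sub, ← smul_comm (M := G) (N := ℕ), hut, hu h hh, sub_self]
  have hκfix : ∀ h ∈ H, ∀ σ : G, σ • (h • ut - ut) = h • ut - ut := fun h hh σ ↦
    hfix _ (hκP h hh) σ
  have hκmul : ∀ h ∈ H, ∀ h' ∈ H, (h * h') • ut - ut = (h • ut - ut) + (h' • ut - ut) := by
    intro h hh h' hh'
    have e : h' • ut = (h' • ut - ut) + ut := (sub_add_cancel _ _).symm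
    conv_lhs => rw [mul_smul, e, smul_add, hκfix h' hh']
    abel
  have hκpow : ∀ h ∈ H, ∀ m : ℕ, h ^ m • ut - ut = m • (h • ut - ut) := by
    intro h hh m
    induction m with
    | zero => rw [pow_zero, one_smul, sub_self, zero_nsmul]
    | succ k ih => rw [pow_succ, hκmul _ (H.pow_mem hh k) _ hh, ih, succ_nsmul]
  have hκI : ∀ g, g ∈ H → g ∈ I → g • ut - ut = 0 := fun g hgH hgI ↦ by
    rw [hunr ut g hgI (hκP g hgH), sub_self]
  have hκN : ∀ g ∈ N, g • ut - ut = 0 := fun g hg ↦ by rw [hNut g hg, sub_self]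
  -- the quotient by `M = I ⊔ N`
  set M : Subgroup G := I ⊔ N with hM
  have hπI : ∀ i ∈ I, (i : G ⧸ M) = 1 := fun i hi ↦
    (QuotientGroup.eq_one_iff i).mpr (Subgroup.mem_sup_left hi)
  have hπN : ∀ n ∈ N, (n : G ⧸ M) = 1 := fun n hn ↦
    (QuotientGroup.eq_one_iff n).mpr (Subgroup.mem_sup_right hn)
  have hκπ : ∀ h ∈ H, ∀ h' ∈ H, (h : G ⧸ M) = h' → h • ut - ut = h' • ut - ut := by
    intro h hh h' hh' hπ
    have hm : h⁻¹ * h' ∈ M := QuotientGroup.eq.mp hπ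
    have hm' : h⁻¹ * h' ∈ (I : Set G) * (N : Set G) := by
      rw [← Subgroup.normal_mul I N]
      exact hm
    obtain ⟨i, hi, n, hn, hin⟩ := Set.mem_mul.mp hm'
    have hiH : i ∈ H := by
      have e : i = h⁻¹ * h' * n⁻¹ := by rw [← hin, mul_inv_cancel_right]
      rw [e]
      exact H.mul_mem (H.mul_mem (H.inv_mem hh) hh') (H.inv_mem (hNH hn))
    have e2 : h' = h * (i * n) := by rw [hin, mul_inv_cancel_left]
    rw [e2, hκmul h hh _ (H.mul_mem hiH (hNH hn)), hκmul i hiH n (hNH hn), hκI i hiH hi, hκN n hn]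
    abel
  -- modulo `M` every element is a power of `F`
  have hpowF : ∀ g : G, ∃ e : ℕ, (g : G ⧸ M) = (F : G ⧸ M) ^ e := by
    intro g
    obtain ⟨e, i, n, hi, hn, rfl⟩ := hdens _ hOpN g
    exact ⟨e, by rw [QuotientGroup.mk_mul, QuotientGroup.mk_mul, QuotientGroup.mk_pow, hπI i hi,
      hπN n hn, mul_one, mul_one]⟩
  choose e he using hpowF
  -- Schreier elements
  have hout : ∀ q : G ⧸ H, ∃ y ∈ H, (F • q).out = F * q.out * y := exists_smul_out_eq H F
  choose y hy hyeq using hout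
  -- `F • Ñ - Ñ = ∑ κ (y q)⁻¹`
  have hterm : ∀ q : G ⧸ H, F • (q.out • ut) = (F • q).out • ut + ((y q)⁻¹ • ut - ut) := by
    intro q
    have e1 : F * q.out = (F • q).out * (y q)⁻¹ := by rw [hyeq, mul_inv_cancel_right]
    have e2 : (y q)⁻¹ • ut = ((y q)⁻¹ • ut - ut) + ut := (sub_add_cancel _ _).symm
    rw [← mul_smul, e1, mul_smul, e2, smul_add, hκfix _ (H.inv_mem (hy q))]
    abel
  have hdiff : F • (∑ q : G ⧸ H, q.out • ut) - ∑ q : G ⧸ H, q.out • ut =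
      ∑ q : G ⧸ H, ((y q)⁻¹ • ut - ut) := by
    rw [Finset.smul_sum]
    simp_rw [hterm]
    rw [Finset.sum_add_distrib, Fintype.sum_bijective (fun q : G ⧸ H ↦ F • q) (MulAction.bijective F)
      (fun q : G ⧸ H ↦ (F • q).out • ut) (fun q : G ⧸ H ↦ q.out • ut) (fun _ ↦ rfl)]
    abel
  -- the transfer, by induction over finite sets of cosets
  have hind : ∀ s : Finset (G ⧸ H), ∃ x ∈ H,
      (x : G ⧸ M) = (F : G ⧸ M) ^ (∑ q ∈ s, ((1 : ℤ) + e q.out - e (F • q).out)) ∧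
        ∑ q ∈ s, ((y q)⁻¹ • ut - ut) = x • ut - ut := by
    intro s
    induction s using Finset.induction_on with
    | empty =>
      exact ⟨1, H.one_mem, by rw [Finset.sum_empty, zpow_zero, QuotientGroup.mk_one],
        by rw [Finset.sum_empty, one_smul, sub_self]⟩
    | @insert q s hq ih =>
      obtain ⟨x, hx, hπx, hκx⟩ := ih
      refine ⟨x * (y q)⁻¹, H.mul_mem hx (H.inv_mem (hy q)), ?_, ?_⟩
      · have ey : (y q)⁻¹ = ((F • q).out)⁻¹ * (F * q.out) := by
          have : y q = (F * q.out)⁻¹ * (F • q).out := by rw [hyeq, inv_mul_cancel_left]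
          rw [this, mul_inv_rev, inv_inv]
        have hπy : (((y q)⁻¹ : G) : G ⧸ M) = (F : G ⧸ M) ^ ((1 : ℤ) + e q.out - e (F • q).out) := by
          rw [ey, QuotientGroup.mk_mul, QuotientGroup.mk_mul, QuotientGroup.mk_inv, he (F • q).out,
            he q.out,
            show (1 : ℤ) + e q.out - e (F • q).out = -(e (F • q).out : ℤ) + (1 + e q.out) by ring,
            zpow_add, zpow_add, zpow_neg, zpow_one, zpow_natCast, zpow_natCast]
        rw [QuotientGroup.mk_mul, hπx, hπy, ← zpow_add, Finset.sum_insert hq, add_comm]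
      · rw [Finset.sum_insert hq, hκx, hκmul x hx _ (H.inv_mem (hy q)), add_comm]
  obtain ⟨x, hx, hπx, hκx⟩ := hind Finset.univ
  have hexp : ∑ q : G ⧸ H, ((1 : ℤ) + e q.out - e (F • q).out) = Fintype.card (G ⧸ H) := by
    rw [Finset.sum_sub_distrib, Finset.sum_add_distrib, Finset.sum_const, Finset.card_univ,
      Fintype.sum_bijective (fun q : G ⧸ H ↦ F • q) (MulAction.bijective F)
        (fun q : G ⧸ H ↦ (e (F • q).out : ℤ)) (fun q : G ⧸ H ↦ (e q.out : ℤ)) (fun _ ↦ rfl)]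
    simp
  rw [hdiff, hκx]
  have hπh₀ : (h₀ : G ⧸ M) = (F : G ⧸ M) ^ f₀ := by
    have e1 := congrArg (QuotientGroup.mk (s := M)) hhi
    rw [QuotientGroup.mk_mul, hπI i₀ hi₀, mul_one, QuotientGroup.mk_pow] at e1
    exact e1
  have hπx' : (x : G ⧸ M) = ((h₀ ^ (P * N₀) : G) : G ⧸ M) := by
    rw [hπx, hexp, hindex, QuotientGroup.mk_pow, hπh₀, ← pow_mul, zpow_natCast]
  rw [hκπ x hx _ (H.pow_mem hh₀ _) hπx', hκpow h₀ hh₀, mul_nsmul, hκP h₀ hh₀, nsmul_zero]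

/-! ### The per-orbit formula and the main theorem -/

omit [NeZero P] in
/-- Two `P`-th roots of the same element are moved identically by `F` (their difference is
`P`-torsion, hence fixed). [folklore] -/
theorem smul_sub_eq_of_nsmul_eq (hfix : ∀ a : A, P • a = 0 → ∀ σ : G, σ • a = a) {st st₀ : A}
    (h : P • st = P • st₀) : F • st - st = F • st₀ - st₀ := by
  have h0 : P • (st - st₀) = 0 := by rw [nsmul_sub, h, sub_self]
  have h1 : F • (st - st₀) = st - st₀ := hfix _ h0 F
  rw [smul_sub] at h1
  rw [← sub_add_cancel (F • st) (F • st₀), h1]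
  abel

/-- **The per-orbit formula.** For the twisted action `σ ⋆ R = σ R + χ₁(σ) T₁ + χ₂(σ) T₂` and a
point `R` with twisted stabiliser `U`: `P ∣ [G : U]`, and every `P`-th root `s̃` of the orbit
sum `∑_{q ∈ G/U} q.out ⋆ R` satisfies `F s̃ - s̃ ≡ -([G:U]/P) χ₂(F) T₂ (mod ℤ T₁)`. Proof: shift
by the reference point `R₁` (`exists_shift_point`) to the `χ₁`-torsor, `z = R - R₁`; choose a
nice point `w` over the fixed field of `U` (`exists_nicePoint`) and split
`z = w + u`, `u ∈ A^U`; the orbit sum is the nice orbit sum of `w` (`exists_root_niceOrbitSum`)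
plus the norm of `u` (`smul_normRoot_sub_self`) plus `[G:U] · R₁`. This is the cocycle-level
shadow of Clark–Sharif's §3.6 computation `Δ_{PD}(j ξ) = D Δ_P(ξ)` against the Tate pairing
with the global point. [folklore] -/
theorem orbit_formula
    (hOp_inf : ∀ U V, Op U → Op V → Op (U ⊓ V)) (hOp_stab : ∀ a : A, Op (MulAction.stabilizer G a))
    (hOp_core : ∀ U, Op U → ∃ N : Subgroup G, N ≤ U ∧ N.Normal ∧ Op N)
    (hdens : ∀ U, Op U → ∀ σ : G, ∃ (n : ℕ) (i u : G), i ∈ I ∧ u ∈ U ∧ σ = F ^ n * i * u)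
    {T₁ T₂ : A} (hT₁ : P • T₁ = 0) (hT₁P : ∀ m : ℕ, m • T₁ = 0 → P ∣ m)
    (hfix : ∀ a : A, P • a = 0 → ∀ σ : G, σ • a = a)
    (χ₁ χ₂ : G → ZMod P) (hχ₁ : ∀ σ τ, χ₁ (σ * τ) = χ₁ σ + χ₁ τ)
    (K₁ : Subgroup G) (hK₁ : ∀ g, g ∈ K₁ ↔ χ₁ g = 0) (hOpK₁ : Op K₁)
    (hIχ₁ : ∀ c : ZMod P, ∃ σ ∈ I, χ₁ σ = c)
    (hunr : ∀ (a : A) (σ : G), σ ∈ I → P • (σ • a - a) = 0 → σ • a = a)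
    (hdiv : ∀ a : A, ∃ b : A, P • b = a)
    (hjunk : ∃ c : A, (∀ σ : G, σ • c = c) ∧ P • c = (P * (P - 1) / 2) • T₁)
    (hnice : ∀ f : ℕ, 0 < f → ∀ a : A, P • a = 0 → ∃ z : A, (∀ σ ∈ I, σ • z = z) ∧ F ^ f • z - z = a)
    {R₁ : A} (hR₁ : ∀ σ : G, σ • R₁ - R₁ = -((χ₂ σ).val • T₂))
    {R : A} {U : Subgroup G}
    (hU : ∀ g, g ∈ U ↔ g • R + ((χ₁ g).val • T₁ + (χ₂ g).val • T₂) = R) [Fintype (G ⧸ U)] :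
    P ∣ Fintype.card (G ⧸ U) ∧ ∀ st : A,
      P • st = ∑ q : G ⧸ U, (q.out • R + ((χ₁ q.out).val • T₁ + (χ₂ q.out).val • T₂)) →
        ∃ m : ℤ, F • st - st = m • T₁ - ((Fintype.card (G ⧸ U) / P) * (χ₂ F).val) • T₂ := by
  have hT₁fix : ∀ σ : G, σ • T₁ = T₁ := hfix T₁ hT₁
  have hR₁' : ∀ σ : G, σ • R₁ = R₁ + -((χ₂ σ).val • T₂) := fun σ ↦ sub_eq_iff_eq_add'.mp (hR₁ σ)
  -- the shifted point `z = R - R₁` and its stabiliser for the `χ₁`-twist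
  set z : A := R - R₁ with hz
  have hU' : ∀ g, g ∈ U ↔ g • z + (χ₁ g).val • T₁ = z := by
    intro g
    rw [hU, hz, smul_sub, hR₁']
    constructor
    · intro h
      rw [← sub_eq_zero] at h ⊢
      rw [← h]
      abel
    · intro h
      rw [← sub_eq_zero] at h ⊢
      rw [← h]
      abel
  haveI : U.FiniteIndex := Subgroup.finiteIndex_of_finite_quotient
  have hU₀U : MulAction.stabilizer G z ⊓ K₁ ≤ U := fun g hg ↦ by
    rw [Subgroup.mem_inf, MulAction.mem_stabilizer_iff, hK₁] at hg
    rw [hU', hg.1, hg.2, ZMod.val_zero, zero_nsmul, add_zero]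
  -- Frobenius data, nice point, splitting `z = w + u`
  obtain ⟨f₀, hf₀pos, hf₀min, hLindex, h₀, hh₀, i₀, hi₀, hhi⟩ :=
    exists_frobeniusData I F Op hdens (hOp_inf _ _ (hOp_stab z) hOpK₁) hU₀U
  obtain ⟨w, hwI, hUw⟩ := exists_nicePoint I F Op hOp_inf hOp_stab hdens hT₁ hT₁P hT₁fix χ₁ hχ₁
    K₁ hK₁ hOpK₁ hunr hnice hU' hf₀pos hf₀min hh₀ hi₀ hhi
  have hUI : ∀ g, g ∈ U → g ∈ I → χ₁ g = 0 := fun g hgU hgI ↦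
    (smul_eq_and_char_eq_zero_of_mem_inf I hT₁ hT₁P χ₁ hunr hU' hgU hgI).2
  obtain ⟨⟨N₀, hrel⟩, s₁, hs₁, m₁, hm₁⟩ :=
    exists_root_niceOrbitSum I F hT₁ hT₁fix χ₁ hχ₁ hIχ₁ hjunk hwI (H := U) hUw hUI
  set u : A := z - w with hudef
  have hu : ∀ h ∈ U, h • u = u := by
    intro h hh
    have e1 : h • z = z - (χ₁ h).val • T₁ := eq_sub_of_add_eq ((hU' h).mp hh)
    have e2 : h • w = w + -((χ₁ h).val • T₁) := sub_eq_iff_eq_add'.mp (hUw h hh)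
    rw [hudef, smul_sub, e1, e2]
    abel
  obtain ⟨ut, hut⟩ := hdiv u
  obtain ⟨N, hNle, hNnormal, hOpN⟩ :=
    hOp_core _ (hOp_inf _ _ (hOp_inf _ _ (hOp_stab z) hOpK₁) (hOp_stab ut))
  haveI : N.Normal := hNnormal
  have hNU : N ≤ U := fun n hn ↦ hU₀U (hNle hn).1
  have hNut : ∀ n ∈ N, n • ut = ut := fun n hn ↦ MulAction.mem_stabilizer_iff.mp (hNle hn).2
  -- the index
  have hindexU : Fintype.card (G ⧸ U) = f₀ * (P * N₀) := by
    rw [← Nat.card_eq_fintype_card, ← Subgroup.index_eq_card, ← Subgroup.relIndex_mul_index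
      (le_sup_left : U ≤ U ⊔ I), hrel, hLindex]
    ring
  have hnorm := smul_normRoot_sub_self I F Op hdens hfix hunr hu hut hNU hNut hOpN hh₀ hi₀ hhi hindexU
  have hPd : P ∣ Fintype.card (G ⧸ U) := ⟨f₀ * N₀, by rw [hindexU]; ring⟩
  refine ⟨hPd, fun st hst ↦ ?_⟩
  -- the orbit sum, split
  have hsplit : ∑ q : G ⧸ U, (q.out • R + ((χ₁ q.out).val • T₁ + (χ₂ q.out).val • T₂)) =
      ∑ q : G ⧸ U, (q.out • w + (χ₁ q.out).val • T₁) + ∑ q : G ⧸ U, q.out • u +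
        Fintype.card (G ⧸ U) • R₁ := by
    have hterm : ∀ g : G, g • R + ((χ₁ g).val • T₁ + (χ₂ g).val • T₂) =
        (g • w + (χ₁ g).val • T₁) + g • u + R₁ := by
      intro g
      have e : R = w + u + R₁ := by rw [hudef, hz]; abel
      conv_lhs => rw [e]
      rw [smul_add, smul_add, hR₁']
      abel
    simp_rw [hterm]
    rw [Finset.sum_add_distrib, Finset.sum_add_distrib, Finset.sum_const, Finset.card_univ]
  -- a convenient root
  set st₀ : A := s₁ + ∑ q : G ⧸ U, q.out • ut + (Fintype.card (G ⧸ U) / P) • R₁ with hst₀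
  have hst₀P : P • st₀ = ∑ q : G ⧸ U, (q.out • R + ((χ₁ q.out).val • T₁ + (χ₂ q.out).val • T₂)) := by
    rw [hsplit, hst₀, nsmul_add, nsmul_add, hs₁, Finset.smul_sum, ← mul_nsmul',
      Nat.mul_div_cancel' hPd]
    congr 2
    refine Finset.sum_congr rfl fun q _ ↦ ?_
    rw [← smul_comm (M := G) (N := ℕ), hut]
  have hF₀ : F • st₀ - st₀ = m₁ • T₁ - ((Fintype.card (G ⧸ U) / P) * (χ₂ F).val) • T₂ := by
    have e : F • st₀ - st₀ = (F • s₁ - s₁) +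
        (F • (∑ q : G ⧸ U, q.out • ut) - ∑ q : G ⧸ U, q.out • ut) +
          (Fintype.card (G ⧸ U) / P) • (F • R₁ - R₁) := by
      rw [hst₀, smul_add, smul_add, smul_comm (M := G) (N := ℕ), nsmul_sub]
      abel
    rw [e, hm₁, hnorm, hR₁, add_zero, neg_nsmul, ← mul_nsmul', sub_eq_add_neg]
  exact ⟨m₁, by rw [smul_sub_eq_of_nsmul_eq F hfix (hst.trans hst₀P.symm), hF₀]⟩

/-- **Clark–Sharif 2010, §3.6 (index `P²`), cocycle-level form: rational divisors on the
torsor of `χ₁ T₁ + χ₂ T₂` with `P`-divisible invariant sum have degree divisible by `P²`.**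
Setting: a group `G` (a decomposition group at a good place `w ∤ P` split in the level field)
acting on `A` (= `E(K̄)`) with a normal subgroup `I` (inertia), an element `F` (Frobenius),
a predicate `Op` on subgroups (the open ones) stable under `⊓`, containing stabilisers and the
kernels of `χ₁, χ₂`, cofinal among normal subgroups, of finite index, and with
`G = ⋃ Fⁿ · I · U` for every `Op U` (density of `⟨F, I⟩`); `T₁, T₂ ∈ A[P]` independent, all of
`A[P]` fixed; `χ₁, χ₂ : G → ℤ/P` additive with `χ₁|_I` onto, `χ₂|_I = 0`, `χ₂(F)` a unit;
`P`-division points of `I`-invariant elements are `I`-invariant (`hunr`); `A` is `P`-divisible;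
a fixed `P`-th root of `(P(P-1)/2) T₁` (`hjunk`; for even `P` this is `E[2P] ⊂ E(K_w)`); and the
nice-point supply `hnice` (`F^f - 1` onto `A[P]` from `A^I`, `f ≥ 1`; from torsion points).
Conclusion: a finite multiset `D ⊂ A` invariant under `σ ⋆ R = σ R + χ₁(σ) T₁ + χ₂(σ) T₂` whose
sum is `P · y` with `y` `G`-invariant has `P² ∣ card D`. Proof: decompose `D` into twisted
orbits; by `orbit_formula`, `F ỹ - ỹ ≡ -(card D / P) χ₂(F) T₂ (mod ℤ T₁)` for any `P`-th root
`ỹ` of the sum; with `ỹ = y` the left side vanishes, so `P ∣ (card D / P) χ₂(F).val`, and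
`χ₂(F)` is a unit. In the arithmetic application (`D` = the trace of a point of the torsor over
a global splitting field `M`, `card D = [M : K]`, sum `= -x`, `x ∈ E(K)` locally `P`-divisible by
(SC2′)) this is the statement "`I(C) = P²`" of Clark–Sharif, proof of Theorem 2, §3.6, obtained
there from the period–index obstruction `Δ_{PD}`, Prop. 6, the Tate pairing and Lemma 19.
[cite: ClarkSharif2010, §3.6] -/
theorem sq_dvd_card_of_twistInvariant
    (hOp_inf : ∀ U V, Op U → Op V → Op (U ⊓ V)) (hOp_stab : ∀ a : A, Op (MulAction.stabilizer G a))
    (hOp_core : ∀ U, Op U → ∃ N : Subgroup G, N ≤ U ∧ N.Normal ∧ Op N)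
    (hOp_fi : ∀ U, Op U → U.FiniteIndex)
    (hdens : ∀ U, Op U → ∀ σ : G, ∃ (n : ℕ) (i u : G), i ∈ I ∧ u ∈ U ∧ σ = F ^ n * i * u)
    {T₁ T₂ : A} (hT₁ : P • T₁ = 0) (hT₂ : P • T₂ = 0)
    (hindep : ∀ m n : ℤ, m • T₁ + n • T₂ = 0 → (P : ℤ) ∣ m ∧ (P : ℤ) ∣ n)
    (hfix : ∀ a : A, P • a = 0 → ∀ σ : G, σ • a = a)
    (χ₁ χ₂ : G → ZMod P) (hχ₁ : ∀ σ τ, χ₁ (σ * τ) = χ₁ σ + χ₁ τ)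
    (hχ₂ : ∀ σ τ, χ₂ (σ * τ) = χ₂ σ + χ₂ τ)
    (K₁ : Subgroup G) (hK₁ : ∀ g, g ∈ K₁ ↔ χ₁ g = 0) (hOpK₁ : Op K₁)
    (K₂ : Subgroup G) (hK₂ : ∀ g, g ∈ K₂ ↔ χ₂ g = 0) (hOpK₂ : Op K₂)
    (hIχ₁ : ∀ c : ZMod P, ∃ σ ∈ I, χ₁ σ = c) (hIχ₂ : ∀ σ ∈ I, χ₂ σ = 0) (hF : IsUnit (χ₂ F))
    (hunr : ∀ (a : A) (σ : G), σ ∈ I → P • (σ • a - a) = 0 → σ • a = a)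
    (hdiv : ∀ a : A, ∃ b : A, P • b = a)
    (hjunk : ∃ c : A, (∀ σ : G, σ • c = c) ∧ P • c = (P * (P - 1) / 2) • T₁)
    (hnice : ∀ f : ℕ, 0 < f → ∀ a : A, P • a = 0 → ∃ z : A, (∀ σ ∈ I, σ • z = z) ∧ F ^ f • z - z = a)
    (D : Multiset A)
    (hD : ∀ (g : G) (R : A), D.count (g • R + ((χ₁ g).val • T₁ + (χ₂ g).val • T₂)) = D.count R)
    (hsum : ∃ y : A, (∀ σ : G, σ • y = y) ∧ D.sum = P • y) :
    P ^ 2 ∣ Multiset.card D := by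
  -- the twist data as a homomorphism `ξ` with invariant values
  set ξ : G → A := fun g ↦ (χ₁ g).val • T₁ + (χ₂ g).val • T₂ with hξ
  have hξm : ∀ σ τ, ξ (σ * τ) = ξ σ + ξ τ := by
    intro σ τ
    simp only [hξ]
    rw [hχ₁, hχ₂, val_add_nsmul hT₁, val_add_nsmul hT₂]
    abel
  have hξf : ∀ σ τ : G, σ • ξ τ = ξ τ := by
    intro σ τ
    simp only [hξ]
    rw [smul_add, smul_comm (M := G) (N := ℕ), smul_comm (M := G) (N := ℕ), hfix T₁ hT₁,
      hfix T₂ hT₂]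
  have hT₁P : ∀ m : ℕ, m • T₁ = 0 → P ∣ m := by
    intro m hm
    have h := (hindep m 0 (by rw [natCast_zsmul, hm, zero_smul, add_zero])).1
    exact Int.natCast_dvd_natCast.mp h
  -- the reference point
  obtain ⟨R₁, -, hR₁⟩ := exists_shift_point I F Op hOp_inf hOp_stab hdens hfix hT₂ χ₂ hχ₂ K₂ hK₂
    hOpK₂ hIχ₂ (fun a ha ↦ by simpa only [pow_one] using hnice 1 one_pos a ha)
  -- induction on the cardinality, peeling off twisted orbits
  suffices hmain : ∀ (n : ℕ) (D : Multiset A), Multiset.card D = n →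
      (∀ (g : G) (R : A), D.count (g • R + ξ g) = D.count R) →
        P ∣ n ∧ ∀ st : A, P • st = D.sum →
          ∃ m : ℤ, F • st - st = m • T₁ - ((n / P) * (χ₂ F).val) • T₂ by
    obtain ⟨hPn, hcl⟩ := hmain _ D rfl hD
    obtain ⟨y, hyfix, hy⟩ := hsum
    obtain ⟨m, hm⟩ := hcl y hy.symm
    rw [hyfix F, sub_self, eq_comm, sub_eq_zero] at hm
    -- `m • T₁ = k • T₂` forces `P ∣ k`
    have hk := (hindep m (-((Multiset.card D / P * (χ₂ F).val : ℕ) : ℤ))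
      (by rw [neg_smul, natCast_zsmul, hm, add_neg_cancel])).2
    rw [Int.dvd_neg, Int.natCast_dvd_natCast] at hk
    have hcop : Nat.Coprime P (χ₂ F).val := by
      have := ZMod.val_coe_unit_coprime hF.unit
      rw [IsUnit.unit_spec] at this
      exact this.symm
    have hk' : P ∣ Multiset.card D / P := hcop.dvd_of_dvd_mul_right hk
    obtain ⟨c, hc⟩ := hk'
    obtain ⟨d, hd⟩ := hPn
    refine ⟨c, ?_⟩
    rw [hd] at hc ⊢
    rw [Nat.mul_div_cancel_left _ (NeZero.pos P)] at hc
    rw [hc]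
    ring
  intro n
  induction n using Nat.strong_induction_on with
  | _ n ih =>
    intro D hn hD
    by_cases h0 : D = 0
    · subst h0
      rw [Multiset.card_zero] at hn
      subst hn
      refine ⟨dvd_zero _, fun st hst ↦ ⟨0, ?_⟩⟩
      rw [Multiset.sum_zero] at hst
      rw [hfix st hst F, sub_self, zero_smul, Nat.zero_div, zero_mul, zero_nsmul, sub_zero]
    obtain ⟨Q, hQ⟩ := Multiset.exists_mem_of_ne_zero h0
    obtain ⟨U, hU⟩ := exists_twistStab ξ hξm hξf Q
    -- `U` has finite index: it contains `Stab(Q) ∩ ker χ₁ ∩ ker χ₂`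
    have hU₀ : MulAction.stabilizer G Q ⊓ K₁ ⊓ K₂ ≤ U := fun g hg ↦ by
      rw [Subgroup.mem_inf, Subgroup.mem_inf, MulAction.mem_stabilizer_iff, hK₁, hK₂] at hg
      rw [hU, hg.1.1]
      simp only [hξ, hg.1.2, hg.2, ZMod.val_zero, zero_nsmul, add_zero]
    haveI : (MulAction.stabilizer G Q ⊓ K₁ ⊓ K₂).FiniteIndex :=
      hOp_fi _ (hOp_inf _ _ (hOp_inf _ _ (hOp_stab Q) hOpK₁) hOpK₂)
    haveI : U.FiniteIndex := Subgroup.finiteIndex_of_le hU₀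
    letI : Fintype (G ⧸ U) := Fintype.ofFinite _
    obtain ⟨hOmem, hOcard, hOsum⟩ := orbitFinset_spec ξ hξm hξf hU
    set O : Finset A := Finset.univ.image fun q : G ⧸ U ↦ q.out • Q + ξ q.out with hOdef
    have hcount : ∀ g, D.count (g • Q + ξ g) = D.count Q := fun g ↦ hD g Q
    have hQO : Q ∈ O := (hOmem Q).mpr ⟨1, twist_one ξ hξm Q⟩
    set m₀ := D.count Q with hm₀
    have hm₀pos : 0 < m₀ := Multiset.count_pos.mpr hQ
    have hcountO : ∀ R ∈ O, D.count R = m₀ := fun R hR ↦ by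
      obtain ⟨g, rfl⟩ := (hOmem R).mp hR
      exact hcount g
    have hle : m₀ • O.val ≤ D := Multiset.le_iff_count.mpr fun R ↦ by
      rw [Multiset.count_nsmul]
      by_cases hR : R ∈ O
      · rw [Multiset.count_eq_one_of_mem O.nodup hR, mul_one, hcountO R hR]
      · rw [Multiset.count_eq_zero.mpr (fun h ↦ hR h), mul_zero]
        exact Nat.zero_le _
    have hmemO_iff : ∀ (g : G) (R : A), g • R + ξ g ∈ O ↔ R ∈ O := by
      intro g R
      rw [hOmem, hOmem]
      constructor
      · rintro ⟨g', hg'⟩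
        refine ⟨g⁻¹ * g', ?_⟩
        rw [twist_mul ξ hξm hξf, hg', twist_inv_twist ξ hξm hξf]
      · rintro ⟨g', rfl⟩
        exact ⟨g * g', twist_mul ξ hξm hξf g g' Q⟩
    have hD' : ∀ (g : G) (R : A), (D - m₀ • O.val).count (g • R + ξ g) = (D - m₀ • O.val).count R := by
      intro g R
      rw [Multiset.count_sub, Multiset.count_sub, hD g R, Multiset.count_nsmul, Multiset.count_nsmul]
      congr 2
      by_cases hR : R ∈ O
      · rw [Multiset.count_eq_one_of_mem O.nodup hR,
          Multiset.count_eq_one_of_mem O.nodup ((hmemO_iff g R).mpr hR)]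
      · rw [Multiset.count_eq_zero.mpr (fun h ↦ hR h),
          Multiset.count_eq_zero.mpr (fun h ↦ hR ((hmemO_iff g R).mp h))]
    have hcardO : Multiset.card (m₀ • O.val) = m₀ * O.card := by
      rw [Multiset.card_nsmul, Finset.card_val]
    have hsumn : Multiset.card (D - m₀ • O.val) + m₀ * O.card = n := by
      rw [Multiset.card_sub hle, hcardO, ← hn]
      exact Nat.sub_add_cancel (hcardO ▸ Multiset.card_le_card hle)
    have hlt : Multiset.card (D - m₀ • O.val) < n := by
      have hOpos : 0 < O.card := Finset.card_pos.mpr ⟨Q, hQO⟩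
      have := Nat.mul_pos hm₀pos hOpos
      omega
    -- the two pieces
    obtain ⟨hPD', hclD'⟩ := ih _ hlt _ rfl hD'
    obtain ⟨hPO, hclO⟩ := orbit_formula I F Op hOp_inf hOp_stab hOp_core hdens hT₁ hT₁P hfix
      χ₁ χ₂ hχ₁ K₁ hK₁ hOpK₁ hIχ₁ hunr hdiv hjunk hnice hR₁ hU
    have hOcard' : O.card = Fintype.card (G ⧸ U) := by
      rw [hOcard, Subgroup.index_eq_card, Nat.card_eq_fintype_card]
    rw [← hsumn]
    refine ⟨dvd_add hPD' (Dvd.dvd.mul_left (hOcard' ▸ hPO) m₀), fun st hst ↦ ?_⟩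
    -- roots
    obtain ⟨sO, hsO⟩ := hdiv (∑ q : G ⧸ U, (q.out • Q + ξ q.out))
    obtain ⟨mO, hmO⟩ := hclO sO hsO
    have hDsum : D.sum = (D - m₀ • O.val).sum + m₀ • ∑ q : G ⧸ U, (q.out • Q + ξ q.out) := by
      conv_lhs => rw [← Multiset.sub_add_cancel hle]
      rw [Multiset.sum_add, Multiset.sum_nsmul, ← hOsum, Finset.sum_eq_multiset_sum, Multiset.map_id']
    have hst' : P • (st - m₀ • sO) = (D - m₀ • O.val).sum := by
      rw [nsmul_sub, hst, hDsum, ← mul_nsmul', mul_comm, mul_nsmul', hsO, add_sub_cancel_right]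
    obtain ⟨m', hm'⟩ := hclD' _ hst'
    refine ⟨m' + m₀ * mO, ?_⟩
    have e : F • st - st = (F • (st - m₀ • sO) - (st - m₀ • sO)) + m₀ • (F • sO - sO) := by
      rw [smul_sub, smul_comm (M := G) (N := ℕ), nsmul_sub]
      abel
    have hPO' : P ∣ O.card := by rw [hOcard']; exact hPO
    rw [e, hm', hmO, ← hOcard', Nat.add_div_of_dvd_right hPD', Nat.mul_div_assoc _ hPO']
    module

/-- **`P` divides the degree of every rational divisor** (the local period is `P`): under the
hypotheses of `sq_dvd_card_of_twistInvariant` except the `P`-divisibility of the sum (and the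
unit condition on `χ₂(F)`), every finite multiset invariant under the twisted action has
cardinality divisible by `P` — each twisted orbit has (`orbit_formula`). In the arithmetic
application this is "`P ∣ [M : K]` for every splitting field `M`", i.e. the local class at `w`
has period exactly `P`, which Clark–Sharif obtain from the ramification of `Φ(a_m, b_m)` at
`v_m` (§3.2, "`P'ξ` is ramified at `π'`, a contradiction"). [cite: ClarkSharif2010, §3.2 and §3.6] -/
theorem dvd_card_of_twistInvariant
    (hOp_inf : ∀ U V, Op U → Op V → Op (U ⊓ V)) (hOp_stab : ∀ a : A, Op (MulAction.stabilizer G a))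
    (hOp_core : ∀ U, Op U → ∃ N : Subgroup G, N ≤ U ∧ N.Normal ∧ Op N)
    (hOp_fi : ∀ U, Op U → U.FiniteIndex)
    (hdens : ∀ U, Op U → ∀ σ : G, ∃ (n : ℕ) (i u : G), i ∈ I ∧ u ∈ U ∧ σ = F ^ n * i * u)
    {T₁ T₂ : A} (hT₁ : P • T₁ = 0) (hT₂ : P • T₂ = 0)
    (hindep : ∀ m n : ℤ, m • T₁ + n • T₂ = 0 → (P : ℤ) ∣ m ∧ (P : ℤ) ∣ n)
    (hfix : ∀ a : A, P • a = 0 → ∀ σ : G, σ • a = a)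
    (χ₁ χ₂ : G → ZMod P) (hχ₁ : ∀ σ τ, χ₁ (σ * τ) = χ₁ σ + χ₁ τ)
    (hχ₂ : ∀ σ τ, χ₂ (σ * τ) = χ₂ σ + χ₂ τ)
    (K₁ : Subgroup G) (hK₁ : ∀ g, g ∈ K₁ ↔ χ₁ g = 0) (hOpK₁ : Op K₁)
    (K₂ : Subgroup G) (hK₂ : ∀ g, g ∈ K₂ ↔ χ₂ g = 0) (hOpK₂ : Op K₂)
    (hIχ₁ : ∀ c : ZMod P, ∃ σ ∈ I, χ₁ σ = c) (hIχ₂ : ∀ σ ∈ I, χ₂ σ = 0)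
    (hunr : ∀ (a : A) (σ : G), σ ∈ I → P • (σ • a - a) = 0 → σ • a = a)
    (hdiv : ∀ a : A, ∃ b : A, P • b = a)
    (hjunk : ∃ c : A, (∀ σ : G, σ • c = c) ∧ P • c = (P * (P - 1) / 2) • T₁)
    (hnice : ∀ f : ℕ, 0 < f → ∀ a : A, P • a = 0 → ∃ z : A, (∀ σ ∈ I, σ • z = z) ∧ F ^ f • z - z = a)
    (D : Multiset A)
    (hD : ∀ (g : G) (R : A), D.count (g • R + ((χ₁ g).val • T₁ + (χ₂ g).val • T₂)) = D.count R) :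
    P ∣ Multiset.card D := by
  -- the twist data as a homomorphism `ξ` with invariant values
  set ξ : G → A := fun g ↦ (χ₁ g).val • T₁ + (χ₂ g).val • T₂ with hξ
  have hξm : ∀ σ τ, ξ (σ * τ) = ξ σ + ξ τ := by
    intro σ τ
    simp only [hξ]
    rw [hχ₁, hχ₂, val_add_nsmul hT₁, val_add_nsmul hT₂]
    abel
  have hξf : ∀ σ τ : G, σ • ξ τ = ξ τ := by
    intro σ τ
    simp only [hξ]
    rw [smul_add, smul_comm (M := G) (N := ℕ), smul_comm (M := G) (N := ℕ), hfix T₁ hT₁,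
      hfix T₂ hT₂]
  have hT₁P : ∀ m : ℕ, m • T₁ = 0 → P ∣ m := by
    intro m hm
    have h := (hindep m 0 (by rw [natCast_zsmul, hm, zero_smul, add_zero])).1
    exact Int.natCast_dvd_natCast.mp h
  obtain ⟨R₁, -, hR₁⟩ := exists_shift_point I F Op hOp_inf hOp_stab hdens hfix hT₂ χ₂ hχ₂ K₂ hK₂
    hOpK₂ hIχ₂ (fun a ha ↦ by simpa only [pow_one] using hnice 1 one_pos a ha)
  -- induction on the cardinality, peeling off twisted orbits
  suffices hmain : ∀ (n : ℕ) (D : Multiset A), Multiset.card D = n →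
      (∀ (g : G) (R : A), D.count (g • R + ξ g) = D.count R) → P ∣ n from hmain _ D rfl hD
  intro n
  induction n using Nat.strong_induction_on with
  | _ n ih =>
    intro D hn hD
    by_cases h0 : D = 0
    · subst h0
      rw [Multiset.card_zero] at hn
      subst hn
      exact dvd_zero _
    obtain ⟨Q, hQ⟩ := Multiset.exists_mem_of_ne_zero h0
    obtain ⟨U, hU⟩ := exists_twistStab ξ hξm hξf Q
    have hU₀ : MulAction.stabilizer G Q ⊓ K₁ ⊓ K₂ ≤ U := fun g hg ↦ by
      rw [Subgroup.mem_inf, Subgroup.mem_inf, MulAction.mem_stabilizer_iff, hK₁, hK₂] at hg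
      rw [hU, hg.1.1]
      simp only [hξ, hg.1.2, hg.2, ZMod.val_zero, zero_nsmul, add_zero]
    haveI : (MulAction.stabilizer G Q ⊓ K₁ ⊓ K₂).FiniteIndex :=
      hOp_fi _ (hOp_inf _ _ (hOp_inf _ _ (hOp_stab Q) hOpK₁) hOpK₂)
    haveI : U.FiniteIndex := Subgroup.finiteIndex_of_le hU₀
    letI : Fintype (G ⧸ U) := Fintype.ofFinite _
    obtain ⟨hOmem, hOcard, -⟩ := orbitFinset_spec ξ hξm hξf hU
    set O : Finset A := Finset.univ.image fun q : G ⧸ U ↦ q.out • Q + ξ q.out with hOdef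
    have hcount : ∀ g, D.count (g • Q + ξ g) = D.count Q := fun g ↦ hD g Q
    have hQO : Q ∈ O := (hOmem Q).mpr ⟨1, twist_one ξ hξm Q⟩
    set m₀ := D.count Q with hm₀
    have hm₀pos : 0 < m₀ := Multiset.count_pos.mpr hQ
    have hcountO : ∀ R ∈ O, D.count R = m₀ := fun R hR ↦ by
      obtain ⟨g, rfl⟩ := (hOmem R).mp hR
      exact hcount g
    have hle : m₀ • O.val ≤ D := Multiset.le_iff_count.mpr fun R ↦ by
      rw [Multiset.count_nsmul]
      by_cases hR : R ∈ O
      · rw [Multiset.count_eq_one_of_mem O.nodup hR, mul_one, hcountO R hR]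
      · rw [Multiset.count_eq_zero.mpr (fun h ↦ hR h), mul_zero]
        exact Nat.zero_le _
    have hmemO_iff : ∀ (g : G) (R : A), g • R + ξ g ∈ O ↔ R ∈ O := by
      intro g R
      rw [hOmem, hOmem]
      constructor
      · rintro ⟨g', hg'⟩
        refine ⟨g⁻¹ * g', ?_⟩
        rw [twist_mul ξ hξm hξf, hg', twist_inv_twist ξ hξm hξf]
      · rintro ⟨g', rfl⟩
        exact ⟨g * g', twist_mul ξ hξm hξf g g' Q⟩
    have hD' : ∀ (g : G) (R : A), (D - m₀ • O.val).count (g • R + ξ g) = (D - m₀ • O.val).count R := by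
      intro g R
      rw [Multiset.count_sub, Multiset.count_sub, hD g R, Multiset.count_nsmul, Multiset.count_nsmul]
      congr 2
      by_cases hR : R ∈ O
      · rw [Multiset.count_eq_one_of_mem O.nodup hR,
          Multiset.count_eq_one_of_mem O.nodup ((hmemO_iff g R).mpr hR)]
      · rw [Multiset.count_eq_zero.mpr (fun h ↦ hR h),
          Multiset.count_eq_zero.mpr (fun h ↦ hR ((hmemO_iff g R).mp h))]
    have hcardO : Multiset.card (m₀ • O.val) = m₀ * O.card := by
      rw [Multiset.card_nsmul, Finset.card_val]
    have hsumn : Multiset.card (D - m₀ • O.val) + m₀ * O.card = n := by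
      rw [Multiset.card_sub hle, hcardO, ← hn]
      exact Nat.sub_add_cancel (hcardO ▸ Multiset.card_le_card hle)
    have hlt : Multiset.card (D - m₀ • O.val) < n := by
      have hOpos : 0 < O.card := Finset.card_pos.mpr ⟨Q, hQO⟩
      have := Nat.mul_pos hm₀pos hOpos
      omega
    have hPD' := ih _ hlt _ rfl hD'
    obtain ⟨hPO, -⟩ := orbit_formula I F Op hOp_inf hOp_stab hOp_core hdens hT₁ hT₁P hfix
      χ₁ χ₂ hχ₁ K₁ hK₁ hOpK₁ hIχ₁ hunr hdiv hjunk hnice hR₁ hU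
    have hOcard' : O.card = Fintype.card (G ⧸ U) := by
      rw [hOcard, Subgroup.index_eq_card, Nat.card_eq_fintype_card]
    rw [← hsumn]
    exact dvd_add hPD' (Dvd.dvd.mul_left (hOcard' ▸ hPO) m₀)

end Specific

end TwistedOrbit

end Literature.NumberTheory.EllipticCurves
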